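import Mathlib.MeasureTheory.Function.L2Space
import Mathlib.Analysis.InnerProductSpace.LinearMap
import Mathlib.Analysis.SpecialFunctions.Integrals.Basic
import Mathlib.LinearAlgebra.Dimension.Finrank
import Mathlib.LinearAlgebra.Dimension.Constructions
import Mathlib.LinearAlgebra.FiniteDimensional.Defs
import Mathlib.NumberTheory.Harmonic.Bounds
import Mathlib.Tactic.Module
import Mathlib.MeasureTheory.Integral.Prod
import Mathlib.Analysis.InnerProductSpace.l2Space
import Mathlib.Analysis.InnerProductSpace.Spectrum
import Mathlib.Analysis.Normed.Operator.Compact.Basic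
import Literature.Analysis.OperatorTheory.CompactSelfAdjointEigenbasis
import Literature.NumberTheory.LFunctions.ZetaScrewTraceClass
import Literature.NumberTheory.LFunctions.ZetaScrewEq301Proofs
import Literature.NumberTheory.LFunctions.ZetaScrewProp31Proofs
import Literature.NumberTheory.LFunctions.ZeroSumWindowBounds
import Literature.NumberTheory.LFunctions.ZetaZeroPowerSums
import Literature.NumberTheory.LFunctions.WeilZeroSum
import Literature.NumberTheory.LFunctions.RHWave0HardyProofs
import Literature.NumberTheory.LFunctions.ZetaZerosProofs
import HarnessLib

/-!
# Suzuki JLMS 2023, Thm. 1.5: the integral operator `𝖦_g[a]` is of trace class, and its trace — PROOF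

LINE 1 — LABEL: RH-FREE corpus THEOREMS (proof-only module: no definition, no named fact; it
DISCHARGES the named facts `Suzuki2023_thm15` (Part I) and `Suzuki2023_thm15_trace` (Part II) of
`ZetaScrewTraceClass.lean`, both printed "unconditionally").
bears_on: LADDER-RH B-C/B-P (COLUMN 6 DBR) — record only. WHAT THIS IS NOT: no positivity or
definiteness of `𝖦_g[a]` is asserted or used (the source, §1: "the traceability of `𝖦_g[a]` does not
depend on the definiteness of `𝖦_g[a]`"); a trace-class property of a kernel built from the screw
function `Ψ` holds whether or not RH does; nothing here bears on the truth of RH.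

Source: M. Suzuki, *Aspects of the screw function corresponding to the Riemann zeta-function*,
J. Lond. Math. Soc. (2) 108 (2023) 1448–1487 = arXiv:2206.03682v4 [bib: `Suzuki2023`], Thm. 1.5
(p. 3, held text `paper:arxiv-2206.03682` p0003:L108–110), printed proof §6.1 (p. 16).

## Main results

* `Suzuki2023_thm15_holds : Suzuki2023_thm15` — for every `0 < a` there is a bounded operator `T` on
  `L²(−a,a) = Lp ℂ 2 (volume.restrict (Ioo (−a) a))` with `T φ = 𝖦_g[a]φ` a.e. for every `φ`
  (`zetaScrewOp`, (1.12)) and `T` of trace class in the tree's sense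
  `Literature.NumberTheory.ConnesConsani2021.IsTraceClass T` (`Σ_n a_n(T) < ∞`, `a_n` = approximation numbers).
* `Suzuki2023_thm15_trace_holds : Suzuki2023_thm15_trace` (PART II, appended) — for every such `T`,
  `Σ_{μ ≠ 0 eigenvalue} dim ker(T − μ) · μ` converges to `∫_{(−a,a)} G_g(t,t) dt` (the display
  "`Tr 𝖦_g[a] = Σ_{n≥1} λ_{a,n} = ∫_{−a}^{a} G_g(t,t) dt`" after Thm. 1.5).

## The printed proof and the road taken here

§6.1 splits `g = g₀ + g₁ + g_∞` by (4.8) and invokes two criteria of the theory of trace ideals: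
continuous kernels Lipschitz of order `> ½` in one variable are trace class [GGK01, Ch. IV Thm. 8.2],
and a Hilbert–Schmidt kernel whose `∂/∂u` in the mean is Hilbert–Schmidt is trace class [GoKr69,
p. 120]. Mathlib has no singular values / trace ideals, and the tree's `IsTraceClass` is the
approximation-number form `Σ_n inf{‖T − F‖ : rank F ≤ n} < ∞`; so this module proves Thm. 1.5
DIRECTLY FOR THIS OPERATOR from the printed zero expansion of the kernel, using only results already
PROVED in the tree (a genuinely shorter road to the tree's predicate; the statement proved is exactly
the printed one):

1. (§H) By (1.9)/(3.1) — `Suzuki2023_eq301` (`ZetaScrewEq301Proofs.lean`, the series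
   `⟨φ₁,φ₂⟩_{G_g,a} = Σ_γ …` for integrable data) — `𝖦_g[a]` is the operator-norm convergent sum of
   the RANK-ONE operators `T_ρ = (−m(ρ)/(ρ−½)²) ⟪e(ρ̄−½) − 1, ·⟫ (e(½−ρ) − 1)` over the non-trivial
   zeros `ρ` (`e(z) = [u ↦ e^{zu}] ∈ L²(−a,a)`, `1 = e(0)`; `Σ_ρ m(ρ)/|ρ−½|² < ∞` by
   `ZetaScrewProp31.summable_zeroOrder_div_norm_sub_half_sq`), and `Tφ = 𝖦_g[a]φ` a.e. by pairing with
   every `ψ ∈ L²(−a,a)` (`tsum_rankOne_apply_ae_eq_zetaScrewOp`).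
2. (§B, §RankOne) Truncating the sum at height `|Im ρ| ≤ N` and absorbing the constant directions
   (`|e(−κ)⟩⟨1|`, `|1⟩⟨e(κ̄)|`, `|1⟩⟨1|`) into two more vectors leaves an operator of rank
   `≤ n(N) + 2`, `n(N) = #{ρ : |Im ρ| ≤ N}`, plus the tail `R_N = Σ_{|Im ρ|>N} λ_ρ ⟪e(κ̄_ρ), ·⟫ e(−κ_ρ)`,
   whose norm is controlled by ALMOST-ORTHOGONALITY of the exponentials at the zeta ordinates: the
   weighted large-sieve (duality / Schur) inequality `Σ_i w_i|⟪v_i,φ⟫|² ≤ (sup_i Σ_j w_j|⟪v_i,v_j⟫|)‖φ‖²`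
   and the Gram bound `|⟪e(z), e(z′)⟫| ≤ 4e^{a}max(a,1)/(1 + |Im z′ − Im z|)` (`|Re z|,|Re z′| ≤ ½`).
3. (§F) The Schur row sums over the zeros are `≤ C/(N√N)` uniformly on the tail (`key_estimate`):
   unit-window zero density `Σ_ρ m(ρ)/(1 + (γ−t)²) ≪ log(|t|+4)` (`ZetaZeroSum.exists_tsum_zeroOrder_div_sq_le`,
   Montgomery–Vaughan Thm. 10.13 / Lemma 12.1) at the shifted centres `t = γ₀ ± j`, `j ≤ |γ₀|/2 + 1`,
   with harmonic weights, plus `Σ_ρ m(ρ)/|γ|^{3/2} < ∞` (`ZetaZeroSum.summable_zeroOrder_div_abs_im_rpow`)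
   for the far zeros. Hence `a_{n(N)+2}(𝖦_g[a]) ≤ C/(N√N)`.
4. (§G, block summation) `n(N+1) − n(N) ≪ log(N+5)` (same window density; `m(ρ) ≥ 1`) and
   `n(N) → ∞` (Hardy, `hardy_infinite_zeros_on_critical_line_holds`); the approximation numbers are
   decreasing, so `Σ_n a_n ≤ Σ_{n<n(0)+2} a_n + Σ_N (n(N+1) − n(N))·C/(N√N) < ∞`.

Everything except the final theorem and `memLp_zetaScrewOp`/`zetaScrewForm_eq_inner` (the `L²`
pairing `⟨φ,ψ⟩_{G_g,a} = ⟪ψ, 𝖦_g[a]φ⟫`, (1.12) and §5 p. 15) is private plumbing in the namespace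
`ZetaScrewTraceClassProof` (generic lemmas [folklore]; the zero-sum estimates carry the cite of their
Montgomery–Vaughan inputs). No `def` is introduced
(the rank-one family is written out in the statements; the exponentials enter as an abstract family
`e : ℂ → L²(−a,a)` with `e z = [u ↦ e^{zu}]` a.e., instantiated by `MemLp.toLp` in the final proof).

## Part II — the trace formula (`Suzuki2023_thm15_trace_holds`)

The source cites [GGK01, Ch. IV, Thm. 8.1] (the trace of a trace-class operator with continuous kernel
is the integral of the diagonal). Here, again directly for this operator: (§K) any `T` realising (1.12)
IS the rank-one expansion `T₀` of Part I (the a.e. clause determines `Tφ ∈ L²`), and it is symmetric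
because `⟨·,·⟩_{G_g,a}` is hermitian (`conj_zetaScrewForm`: real symmetric kernel, Fubini on the square);
(§I) `T₀` is compact (operator-norm limit of finite-rank partial sums), so the tree's Hilbert–Schmidt
theorem `Literature.Analysis.OperatorTheory.exists_hilbertBasis_eigenvectors` (Reed–Simon I, VI.16)
gives a Hilbert basis `b` with `T₀ bᵢ = κᵢ bᵢ`, `κᵢ ∈ ℝ`; the "trace in the basis `b`",
`Σ_i ⟪bᵢ, T₀ bᵢ⟫ = Σ_i κ_i`, converges absolutely to `Σ_ρ λ_ρ ⟪y_ρ, x_ρ⟫` (Parseval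
`HilbertBasis.hasSum_inner_mul_inner`, Bessel, `|ab| ≤ (a²+b²)/2`, Fubini for sums); (§L) the diagonal
sum is `Σ_ρ ∫ 2m(ρ)(cosh κu − 1)/κ² du = ∫ 2Ψ = ∫ G_g(t,t) dt` ((1.9), termwise integration over the
countable zero set); (§J) regrouping `Σ_i κ_i` by value (`HasSum.tsum_fiberwise`) counts each non-zero
eigenvalue `μ` exactly `#{i : κᵢ = μ} = dim ker(T₀ − μ)` times (the `bᵢ` with `κᵢ = μ` are
orthonormal in, and span, the finite-dimensional eigenspace — an eigenvector for `μ` is orthogonal to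
every `bᵢ` with `κᵢ ≠ μ`).

Deliberately NOT here: Thm. 1.4 `⟸` (`Suzuki2023_thm14`, §5.2 via Thm. 4.3).

## References

* M. Suzuki, J. Lond. Math. Soc. (2) 108 (2023) 1448–1487, Thm. 1.5, §6.1. [`Suzuki2023`]
* H. L. Montgomery, R. C. Vaughan, *Multiplicative Number Theory I*, CUP 2007, Thm. 10.13, Lemma 12.1.
  [`MontgomeryVaughan2007`]
* G. H. Hardy, C. R. Acad. Sci. Paris 158 (1914). [`Hardy1914`]
* M. Reed, B. Simon, *Methods of Modern Mathematical Physics I* (1980), Thm. VI.16 (through the tree's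
  `exists_hilbertBasis_eigenvectors`). [`ReedSimonI1980`]
* (printed proof only) I. Gohberg, S. Goldberg, N. Krupnik, *Traces and determinants of linear
  operators* (2000), Ch. IV Thms. 8.1–8.2; I. Gohberg, M. G. Kreĭn, *Introduction to the theory of
  linear nonselfadjoint operators* (1969), p. 120.
-/

noncomputable section

open scoped InnerProductSpace ComplexConjugate
open Filter Topology MeasureTheory Set Complex Finset

namespace Literature.NumberTheory.LFunctions

namespace ZetaScrewTraceClassProof

/-! ## A. Approximation numbers: the three elementary facts used -/

section ApproxNumber

variable {𝕜 : Type*} [RCLike 𝕜] {E : Type*} [NormedAddCommGroup E] [NormedSpace 𝕜 E]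

open ConnesConsani2021

/-- The defining set of `approxNumber T n` is bounded below by `0`. [folklore] -/
private theorem bddBelow_approxSet (T : E →L[𝕜] E) (n : ℕ) :
    BddBelow {r : ℝ | ∃ F : E →L[𝕜] E,
      Module.rank 𝕜 (LinearMap.range (F : E →ₗ[𝕜] E)) ≤ n ∧ ‖T - F‖ = r} :=
  ⟨0, by rintro r ⟨F, -, rfl⟩; exact norm_nonneg _⟩

/-- `0` has rank `≤ n`, so `‖T‖` belongs to the defining set of `approxNumber T n`. [folklore] -/
private theorem norm_mem_approxSet (T : E →L[𝕜] E) (n : ℕ) :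
    ‖T‖ ∈ {r : ℝ | ∃ F : E →L[𝕜] E,
      Module.rank 𝕜 (LinearMap.range (F : E →ₗ[𝕜] E)) ≤ n ∧ ‖T - F‖ = r} := by
  refine ⟨0, ?_, by rw [sub_zero]⟩
  have h : LinearMap.range ((0 : E →L[𝕜] E) : E →ₗ[𝕜] E) = ⊥ := by
    rw [ContinuousLinearMap.toLinearMap_zero, LinearMap.range_zero]
  rw [h, rank_bot]
  exact zero_le

/-- `0 ≤ a_n(T)`. [folklore] -/
private theorem approxNumber_nonneg (T : E →L[𝕜] E) (n : ℕ) : 0 ≤ approxNumber T n := by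
  unfold approxNumber
  refine Real.sInf_nonneg ?_
  rintro r ⟨F, -, rfl⟩
  exact norm_nonneg _

/-- `a_n(T) ≤ ‖T − F‖` for every `F` of rank `≤ n` (the infimum is over such `F`). [folklore] -/
private theorem approxNumber_le_of_rank_le (T F : E →L[𝕜] E) {n : ℕ}
    (hF : Module.rank 𝕜 (LinearMap.range (F : E →ₗ[𝕜] E)) ≤ n) :
    approxNumber T n ≤ ‖T - F‖ := by
  unfold approxNumber
  exact csInf_le (bddBelow_approxSet T n) ⟨F, hF, rfl⟩

/-- `a_n(T) ≤ ‖T‖`. [folklore] -/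
private theorem approxNumber_le_norm (T : E →L[𝕜] E) (n : ℕ) : approxNumber T n ≤ ‖T‖ := by
  unfold approxNumber
  exact csInf_le (bddBelow_approxSet T n) (norm_mem_approxSet T n)

/-- The approximation numbers decrease: `a_n(T) ≤ a_m(T)` for `m ≤ n` (a rank-`≤ m` operator has
rank `≤ n`). [folklore] -/
private theorem approxNumber_antitone (T : E →L[𝕜] E) : Antitone (approxNumber T) := by
  intro m n hmn
  unfold approxNumber
  refine csInf_le_csInf (bddBelow_approxSet T n) ⟨‖T‖, norm_mem_approxSet T m⟩ ?_
  rintro r ⟨F, hF, rfl⟩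
  exact ⟨F, hF.trans (by exact_mod_cast hmn), rfl⟩

end ApproxNumber

/-! ## B. The weighted large-sieve (duality) inequality in an inner product space -/

section LargeSieve

variable {E : Type*} [NormedAddCommGroup E] [InnerProductSpace ℂ E]

/-- **Weighted large sieve by duality.** For a finite family of vectors `v i` with weights
`w i ≥ 0`, if every row sum `Σ_j w_j |⟪v_i, v_j⟫|` is at most `K`, then
`Σ_i w_i |⟪v_i, φ⟫|² ≤ K ‖φ‖²` for every `φ` (Selberg's duality / Schur's test: with
`u = Σ_i w_i ⟪v_i,φ⟫ v_i` one has `S = ⟪u, φ⟫ ≤ ‖u‖‖φ‖` and `‖u‖² ≤ K S` by the arithmetic–geometric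
mean inequality). [folklore] -/
private theorem largeSieve {ι : Type*} (s : Finset ι) (v : ι → E) (w : ι → ℝ)
    (hw : ∀ i ∈ s, 0 ≤ w i) {K : ℝ} (hK0 : 0 ≤ K)
    (hK : ∀ i ∈ s, ∑ j ∈ s, w j * ‖⟪v i, v j⟫_ℂ‖ ≤ K) (φ : E) :
    ∑ i ∈ s, w i * ‖⟪v i, φ⟫_ℂ‖ ^ 2 ≤ K * ‖φ‖ ^ 2 := by
  classical
  set c : ι → ℂ := fun i ↦ ⟪v i, φ⟫_ℂ with hc
  set S : ℝ := ∑ i ∈ s, w i * ‖c i‖ ^ 2 with hS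
  have hS0 : 0 ≤ S := Finset.sum_nonneg fun i hi ↦ mul_nonneg (hw i hi) (sq_nonneg _)
  set u : E := ∑ i ∈ s, ((w i : ℂ) * c i) • v i with hu
  -- `⟪u, φ⟫ = S`
  have h1 : ⟪u, φ⟫_ℂ = (S : ℂ) := by
    rw [hu, sum_inner, hS]
    push_cast
    refine Finset.sum_congr rfl fun i _ ↦ ?_
    rw [inner_smul_left, map_mul, Complex.conj_ofReal]
    change (w i : ℂ) * (starRingEnd ℂ) (c i) * c i = _
    rw [mul_assoc, Complex.conj_mul' (c i)]
  -- `S ≤ ‖u‖ ‖φ‖`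
  have h2 : S ≤ ‖u‖ * ‖φ‖ := by
    have := norm_inner_le_norm (𝕜 := ℂ) u φ
    rwa [h1, Complex.norm_real, Real.norm_of_nonneg hS0] at this
  -- `‖u‖² ≤ K S`
  have h3 : ‖u‖ ^ 2 ≤ K * S := by
    have hnorm : (‖u‖ ^ 2 : ℝ) = RCLike.re ⟪u, u⟫_ℂ := by
      rw [inner_self_eq_norm_sq_to_K]; norm_cast
    -- expand `⟪u,u⟫` as a double sum
    have hexp : ⟪u, u⟫_ℂ = ∑ i ∈ s, ∑ j ∈ s,
        (starRingEnd ℂ) ((w i : ℂ) * c i) * (((w j : ℂ) * c j) * ⟪v i, v j⟫_ℂ) := by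
      rw [hu, sum_inner]
      refine Finset.sum_congr rfl fun i _ ↦ ?_
      rw [inner_sum]
      refine Finset.sum_congr rfl fun j _ ↦ ?_
      rw [inner_smul_left, inner_smul_right]
    have hre : RCLike.re ⟪u, u⟫_ℂ ≤ ∑ i ∈ s, ∑ j ∈ s, w i * w j * ‖c i‖ * ‖c j‖ * ‖⟪v i, v j⟫_ℂ‖ := by
      rw [hexp, map_sum]
      refine Finset.sum_le_sum fun i hi ↦ ?_
      rw [map_sum]
      refine Finset.sum_le_sum fun j hj ↦ ?_
      refine (RCLike.re_le_norm _).trans ?_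
      rw [norm_mul, norm_mul, map_mul, norm_mul, norm_mul, Complex.norm_conj, Complex.norm_conj,
        Complex.norm_real, Complex.norm_real, Real.norm_of_nonneg (hw i hi),
        Real.norm_of_nonneg (hw j hj)]
      ring_nf
      rfl
    -- AM–GM termwise
    have hamgm : ∀ i ∈ s, ∀ j ∈ s,
        w i * w j * ‖c i‖ * ‖c j‖ * ‖⟪v i, v j⟫_ℂ‖ ≤
          (w i * ‖c i‖ ^ 2 * (w j * ‖⟪v i, v j⟫_ℂ‖) +
            w j * ‖c j‖ ^ 2 * (w i * ‖⟪v j, v i⟫_ℂ‖)) / 2 := by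
      intro i hi j hj
      rw [norm_inner_symm (v j) (v i)]
      have h0 : 0 ≤ w i * w j * ‖⟪v i, v j⟫_ℂ‖ := by
        have := hw i hi; have := hw j hj; positivity
      nlinarith [sq_nonneg (‖c i‖ - ‖c j‖), h0]
    have hsum : ∑ i ∈ s, ∑ j ∈ s, w i * w j * ‖c i‖ * ‖c j‖ * ‖⟪v i, v j⟫_ℂ‖ ≤
        ∑ i ∈ s, ∑ j ∈ s, (w i * ‖c i‖ ^ 2 * (w j * ‖⟪v i, v j⟫_ℂ‖) +
            w j * ‖c j‖ ^ 2 * (w i * ‖⟪v j, v i⟫_ℂ‖)) / 2 :=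
      Finset.sum_le_sum fun i hi ↦ Finset.sum_le_sum fun j hj ↦ hamgm i hi j hj
    have hsymm : ∑ i ∈ s, ∑ j ∈ s, (w i * ‖c i‖ ^ 2 * (w j * ‖⟪v i, v j⟫_ℂ‖) +
            w j * ‖c j‖ ^ 2 * (w i * ‖⟪v j, v i⟫_ℂ‖)) / 2 =
        ∑ i ∈ s, w i * ‖c i‖ ^ 2 * ∑ j ∈ s, w j * ‖⟪v i, v j⟫_ℂ‖ := by
      have hsplit : ∀ i ∈ s, ∑ j ∈ s, (w i * ‖c i‖ ^ 2 * (w j * ‖⟪v i, v j⟫_ℂ‖) +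
            w j * ‖c j‖ ^ 2 * (w i * ‖⟪v j, v i⟫_ℂ‖)) / 2 =
          (∑ j ∈ s, w i * ‖c i‖ ^ 2 * (w j * ‖⟪v i, v j⟫_ℂ‖)) / 2 +
            (∑ j ∈ s, w j * ‖c j‖ ^ 2 * (w i * ‖⟪v j, v i⟫_ℂ‖)) / 2 := by
        intro i _
        rw [← add_div, ← Finset.sum_add_distrib, Finset.sum_div]
      have hcomm : ∑ i ∈ s, ∑ j ∈ s, w j * ‖c j‖ ^ 2 * (w i * ‖⟪v j, v i⟫_ℂ‖) =
          ∑ i ∈ s, ∑ j ∈ s, w i * ‖c i‖ ^ 2 * (w j * ‖⟪v i, v j⟫_ℂ‖) := Finset.sum_comm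
      rw [Finset.sum_congr rfl hsplit, Finset.sum_add_distrib, ← Finset.sum_div, ← Finset.sum_div,
        hcomm, ← add_div, ← two_mul, mul_div_cancel_left₀ _ (two_ne_zero)]
      refine Finset.sum_congr rfl fun i _ ↦ ?_
      rw [Finset.mul_sum]
    have hKS : ∑ i ∈ s, w i * ‖c i‖ ^ 2 * ∑ j ∈ s, w j * ‖⟪v i, v j⟫_ℂ‖ ≤ K * S := by
      rw [hS, Finset.mul_sum]
      refine Finset.sum_le_sum fun i hi ↦ ?_
      have h0 : 0 ≤ w i * ‖c i‖ ^ 2 := mul_nonneg (hw i hi) (sq_nonneg _)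
      calc w i * ‖c i‖ ^ 2 * ∑ j ∈ s, w j * ‖⟪v i, v j⟫_ℂ‖
          ≤ w i * ‖c i‖ ^ 2 * K := mul_le_mul_of_nonneg_left (hK i hi) h0
        _ = K * (w i * ‖c i‖ ^ 2) := by ring
    calc ‖u‖ ^ 2 = RCLike.re ⟪u, u⟫_ℂ := hnorm
      _ ≤ _ := hre
      _ ≤ _ := hsum
      _ = _ := hsymm
      _ ≤ K * S := hKS
  -- conclude
  change S ≤ K * ‖φ‖ ^ 2
  by_cases hS' : S = 0
  · rw [hS']; positivity
  · have hSpos : 0 < S := lt_of_le_of_ne hS0 (Ne.symm hS')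
    have h4 : S ^ 2 ≤ K * S * ‖φ‖ ^ 2 := by
      calc S ^ 2 ≤ (‖u‖ * ‖φ‖) ^ 2 := pow_le_pow_left₀ hS0 h2 2
        _ = ‖u‖ ^ 2 * ‖φ‖ ^ 2 := by ring
        _ ≤ K * S * ‖φ‖ ^ 2 := by gcongr
    nlinarith

end LargeSieve


section GenericOps

variable {E : Type*} [NormedAddCommGroup E] [InnerProductSpace ℂ E]

/-- **Operator norm of a finite sum of rank-one operators by almost-orthogonality.** If the
families `p`, `q` satisfy the Schur (row-sum) condition with weights `‖λ_j‖` and constant `K`,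
then `‖Σ_i λ_i ⟪q_i, ·⟫ p_i‖ ≤ K` (Cauchy–Schwarz between the two large-sieve inequalities).
[folklore] -/
private theorem norm_sum_rankOne_le {ι : Type*} (s : Finset ι) (p q : ι → E) (lam : ι → ℂ)
    {K : ℝ} (hK0 : 0 ≤ K)
    (hp : ∀ i ∈ s, ∑ j ∈ s, ‖lam j‖ * ‖⟪p i, p j⟫_ℂ‖ ≤ K)
    (hq : ∀ i ∈ s, ∑ j ∈ s, ‖lam j‖ * ‖⟪q i, q j⟫_ℂ‖ ≤ K) :
    ‖∑ i ∈ s, lam i • (innerSL ℂ (q i)).smulRight (p i)‖ ≤ K := by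
  refine ContinuousLinearMap.opNorm_le_bound _ hK0 fun φ ↦ ?_
  set ψ : E := (∑ i ∈ s, lam i • (innerSL ℂ (q i)).smulRight (p i)) φ with hψ
  -- `⟪ψ, ψ⟫ = Σ λ_i ⟪q_i, φ⟫ ⟪ψ, p_i⟫`
  have happly : ψ = ∑ i ∈ s, (lam i * ⟪q i, φ⟫_ℂ) • p i := by
    rw [hψ, _root_.sum_apply]
    refine Finset.sum_congr rfl fun i _ ↦ ?_
    rw [smul_apply, ContinuousLinearMap.smulRight_apply, innerSL_apply_apply, smul_smul]
  have hinner : ⟪ψ, ψ⟫_ℂ = ∑ i ∈ s, lam i * ⟪q i, φ⟫_ℂ * ⟪ψ, p i⟫_ℂ := by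
    have e1 : ⟪ψ, ψ⟫_ℂ = ⟪ψ, ∑ i ∈ s, (lam i * ⟪q i, φ⟫_ℂ) • p i⟫_ℂ := by rw [← happly]
    rw [e1, inner_sum]
    refine Finset.sum_congr rfl fun i _ ↦ ?_
    rw [inner_smul_right]
  have hnorm_sq : ‖ψ‖ ^ 2 ≤ ∑ i ∈ s, ‖lam i‖ * ‖⟪q i, φ⟫_ℂ‖ * ‖⟪p i, ψ⟫_ℂ‖ := by
    have h1 : (‖ψ‖ ^ 2 : ℝ) = ‖⟪ψ, ψ⟫_ℂ‖ := by
      rw [inner_self_eq_norm_sq_to_K, norm_pow]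
      simp
    rw [h1, hinner]
    refine (norm_sum_le _ _).trans (le_of_eq (Finset.sum_congr rfl fun i _ ↦ ?_))
    rw [norm_mul, norm_mul, norm_inner_symm ψ (p i)]
  -- Cauchy–Schwarz
  have hCS : (∑ i ∈ s, ‖lam i‖ * ‖⟪q i, φ⟫_ℂ‖ * ‖⟪p i, ψ⟫_ℂ‖) ^ 2 ≤
      (∑ i ∈ s, ‖lam i‖ * ‖⟪q i, φ⟫_ℂ‖ ^ 2) * (∑ i ∈ s, ‖lam i‖ * ‖⟪p i, ψ⟫_ℂ‖ ^ 2) := by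
    have := Finset.sum_mul_sq_le_sq_mul_sq s (fun i ↦ Real.sqrt ‖lam i‖ * ‖⟪q i, φ⟫_ℂ‖)
      (fun i ↦ Real.sqrt ‖lam i‖ * ‖⟪p i, ψ⟫_ℂ‖)
    have hsq : ∀ i, Real.sqrt ‖lam i‖ * Real.sqrt ‖lam i‖ = ‖lam i‖ := fun i ↦
      Real.mul_self_sqrt (norm_nonneg _)
    refine le_of_eq_of_le ?_ (this.trans (le_of_eq ?_))
    · congr 1
      refine Finset.sum_congr rfl fun i _ ↦ ?_
      calc ‖lam i‖ * ‖⟪q i, φ⟫_ℂ‖ * ‖⟪p i, ψ⟫_ℂ‖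
          = (Real.sqrt ‖lam i‖ * Real.sqrt ‖lam i‖) * ‖⟪q i, φ⟫_ℂ‖ * ‖⟪p i, ψ⟫_ℂ‖ := by rw [hsq]
        _ = _ := by ring
    · congr 1
      · refine Finset.sum_congr rfl fun i _ ↦ ?_
        rw [mul_pow, Real.sq_sqrt (norm_nonneg _)]
      · refine Finset.sum_congr rfl fun i _ ↦ ?_
        rw [mul_pow, Real.sq_sqrt (norm_nonneg _)]
  have hLSq := largeSieve s q (fun i ↦ ‖lam i‖) (fun i _ ↦ norm_nonneg _) hK0 hq φ
  have hLSp := largeSieve s p (fun i ↦ ‖lam i‖) (fun i _ ↦ norm_nonneg _) hK0 hp ψ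
  -- combine: `‖ψ‖⁴ ≤ K‖φ‖² · K‖ψ‖²`
  have h4 : (‖ψ‖ ^ 2) ^ 2 ≤ (K * ‖φ‖ ^ 2) * (K * ‖ψ‖ ^ 2) := by
    calc (‖ψ‖ ^ 2) ^ 2 ≤ (∑ i ∈ s, ‖lam i‖ * ‖⟪q i, φ⟫_ℂ‖ * ‖⟪p i, ψ⟫_ℂ‖) ^ 2 :=
          pow_le_pow_left₀ (sq_nonneg _) hnorm_sq 2
      _ ≤ _ := hCS
      _ ≤ _ := by
          have h0 : 0 ≤ ∑ i ∈ s, ‖lam i‖ * ‖⟪q i, φ⟫_ℂ‖ ^ 2 :=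
            Finset.sum_nonneg fun i _ ↦ by positivity
          gcongr
  have hK' : 0 ≤ K * ‖φ‖ := mul_nonneg hK0 (norm_nonneg _)
  by_cases hψ0 : ‖ψ‖ = 0
  · rw [hψ0]; exact hK'
  · have hpos : 0 < ‖ψ‖ := lt_of_le_of_ne (norm_nonneg _) (Ne.symm hψ0)
    have h6 : (‖ψ‖ ^ 2) ^ 2 ≤ (K * ‖φ‖) ^ 2 * ‖ψ‖ ^ 2 := by
      calc (‖ψ‖ ^ 2) ^ 2 ≤ (K * ‖φ‖ ^ 2) * (K * ‖ψ‖ ^ 2) := h4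
        _ = (K * ‖φ‖) ^ 2 * ‖ψ‖ ^ 2 := by ring
    have h5 : ‖ψ‖ ^ 2 ≤ (K * ‖φ‖) ^ 2 :=
      le_of_mul_le_mul_right (by linarith [h6]) (by positivity : 0 < ‖ψ‖ ^ 2)
    exact (pow_le_pow_iff_left₀ (norm_nonneg _) hK' two_ne_zero).1 h5

omit [InnerProductSpace ℂ E] in
/-- If every finite partial sum of a summable family in a normed group has norm `≤ K`, so does
the sum. [folklore] -/
private theorem norm_tsum_le_of_sum_le {ι : Type*} {F : Type*} [NormedAddCommGroup F] [CompleteSpace F]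
    {f : ι → F} (hf : Summable f) {K : ℝ} (hK : ∀ s : Finset ι, ‖∑ i ∈ s, f i‖ ≤ K) :
    ‖∑' i, f i‖ ≤ K := by
  have h := hf.hasSum
  rw [HasSum] at h
  exact le_of_tendsto' (h.norm) hK

/-- An operator whose values all lie in the span of a finite set `S` has rank `≤ #S`. [folklore] -/
private theorem rank_range_le_card {A : E →L[ℂ] E} (S : Finset E)
    (hA : ∀ φ, A φ ∈ Submodule.span ℂ (S : Set E)) :
    Module.rank ℂ (LinearMap.range (A : E →ₗ[ℂ] E)) ≤ S.card := by
  have hle : LinearMap.range (A : E →ₗ[ℂ] E) ≤ Submodule.span ℂ (S : Set E) := by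
    rintro v ⟨φ, rfl⟩
    exact hA φ
  calc Module.rank ℂ (LinearMap.range (A : E →ₗ[ℂ] E))
      ≤ Module.rank ℂ (Submodule.span ℂ (S : Set E)) := Submodule.rank_mono hle
    _ ≤ Cardinal.mk (S : Set E) := rank_span_le _
    _ = S.card := Cardinal.mk_coe_finset

end GenericOps

/-! ### The block summation lemma -/

/-- **Block summation.** Let `A ≥ 0` be antitone, `h : ℕ → ℕ` monotone and unbounded, with
`A (h N) ≤ c N` and `h (N+1) − h N ≤ d N`, `c, d ≥ 0` and `Σ d N · c N < ∞`. Then `Σ A < ∞`: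
on the block `h N ≤ n < h (N+1)` each term is `≤ c N` and there are `≤ d N` of them. [folklore] -/
private theorem summable_of_antitone_blocks {A : ℕ → ℝ} (hA0 : ∀ n, 0 ≤ A n) (hA : Antitone A)
    {h : ℕ → ℕ} (hmono : Monotone h) (htop : Tendsto h atTop atTop)
    {c d : ℕ → ℝ} (hc0 : ∀ N, 0 ≤ c N) (hc : ∀ N, A (h N) ≤ c N)
    (hd : ∀ N, ((h (N + 1) : ℝ) - h N) ≤ d N) (hsum : Summable fun N ↦ d N * c N) :
    Summable A := by
  have hd0 : ∀ N, 0 ≤ d N := fun N ↦ by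
    have := hd N
    have h1 : (h N : ℝ) ≤ h (N + 1) := by exact_mod_cast hmono (Nat.le_succ N)
    linarith
  -- the sum over one block
  have hblock : ∀ N, ∑ n ∈ Finset.Ico (h N) (h (N + 1)), A n ≤ d N * c N := by
    intro N
    calc ∑ n ∈ Finset.Ico (h N) (h (N + 1)), A n
        ≤ ∑ n ∈ Finset.Ico (h N) (h (N + 1)), c N := by
          refine Finset.sum_le_sum fun n hn ↦ ?_
          exact (hA (Finset.mem_Ico.1 hn).1).trans (hc N)
      _ = ((h (N + 1) : ℝ) - h N) * c N := by
          rw [Finset.sum_const, Nat.card_Ico, nsmul_eq_mul, Nat.cast_sub (hmono (Nat.le_succ N))]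
      _ ≤ d N * c N := mul_le_mul_of_nonneg_right (hd N) (hc0 N)
  -- partial sums up to `h M`
  have hpartial : ∀ M, ∑ n ∈ Finset.range (h M), A n ≤
      ∑ n ∈ Finset.range (h 0), A n + ∑ N ∈ Finset.range M, d N * c N := by
    intro M
    induction M with
    | zero => simp
    | succ M ih =>
      rw [Finset.sum_range_succ, ← Finset.sum_range_add_sum_Ico _ (hmono (Nat.le_succ M))]
      linarith [hblock M]
  set B : ℝ := ∑ n ∈ Finset.range (h 0), A n + ∑' N, d N * c N with hB
  refine summable_of_sum_range_le hA0 (c := B) fun n ↦ ?_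
  -- pick `M` with `n ≤ h M`
  obtain ⟨M, hM⟩ := (htop.eventually (eventually_ge_atTop n)).exists
  calc ∑ i ∈ Finset.range n, A i ≤ ∑ i ∈ Finset.range (h M), A i :=
        Finset.sum_le_sum_of_subset_of_nonneg (Finset.range_mono hM) fun i _ _ ↦ hA0 i
    _ ≤ ∑ n ∈ Finset.range (h 0), A n + ∑ N ∈ Finset.range M, d N * c N := hpartial M
    _ ≤ B := by
        rw [hB]
        gcongr
        exact (hsum.sum_le_tsum _ fun N _ ↦ mul_nonneg (hd0 N) (hc0 N))


/-! ## C. Exponentials in `L²(−a,a)` -/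

section Window

variable {a : ℝ}

/-- `u ↦ e^{zu}` is in `L²(−a,a)` (continuous and bounded on a finite window). [folklore] -/
private theorem memLp_two_cexp (a : ℝ) (z : ℂ) :
    MemLp (fun u : ℝ ↦ cexp (z * u)) 2 (volume.restrict (Ioo (-a) a)) := by
  have hcont : Continuous fun u : ℝ ↦ cexp (z * u) := by fun_prop
  refine (memLp_top_of_bound hcont.aestronglyMeasurable (Real.exp (|z.re| * |a|)) ?_).mono_exponent
    le_top
  refine (ae_restrict_mem measurableSet_Ioo).mono fun u hu ↦ ?_
  rw [Complex.norm_exp, Real.exp_le_exp, Complex.re_mul_ofReal]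
  calc z.re * u ≤ |z.re * u| := le_abs_self _
    _ = |z.re| * |u| := abs_mul _ _
    _ ≤ |z.re| * |a| := by
        refine mul_le_mul_of_nonneg_left ?_ (abs_nonneg _)
        rw [abs_le]
        constructor <;> nlinarith [hu.1, hu.2, le_abs_self a, neg_abs_le a]

variable (e : ℂ → Lp ℂ 2 (volume.restrict (Ioo (-a) a)))

/-- For a family `e z ∈ L²(−a,a)` representing `u ↦ e^{zu}`: `⟪e z, φ⟫ = ∫ e^{z̄u} φ(u) du`.
[folklore] -/
private theorem inner_expVec_left (he : ∀ z, (e z : ℝ → ℂ) =ᵐ[volume.restrict (Ioo (-a) a)] fun u ↦ cexp (z * u))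
    (z : ℂ) (φ : Lp ℂ 2 (volume.restrict (Ioo (-a) a))) :
    ⟪e z, φ⟫_ℂ = ∫ u, cexp (conj z * u) * (φ : ℝ → ℂ) u ∂(volume.restrict (Ioo (-a) a)) := by
  rw [MeasureTheory.L2.inner_def]
  refine integral_congr_ae ((he z).mono fun u hu ↦ ?_)
  dsimp only
  rw [hu, RCLike.inner_apply, ← Complex.exp_conj, map_mul, Complex.conj_ofReal, mul_comm]

/-- `⟪e z, e z'⟫ = ∫_{(−a,a)} e^{(z̄ + z')u} du`. [folklore] -/
private theorem inner_expVec_expVec (he : ∀ z, (e z : ℝ → ℂ) =ᵐ[volume.restrict (Ioo (-a) a)] fun u ↦ cexp (z * u))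
    (z z' : ℂ) :
    ⟪e z, e z'⟫_ℂ = ∫ u in Ioo (-a) a, cexp ((conj z + z') * u) := by
  rw [inner_expVec_left e he]
  refine integral_congr_ae ((he z').mono fun u hu ↦ ?_)
  dsimp only
  rw [hu, ← Complex.exp_add, add_mul]

/-- The window integral of `e^{wu}` is at most `2a·e^{a}` in norm when `|Re w| ≤ 1`. [folklore] -/
private theorem norm_setIntegral_cexp_le (ha : 0 < a) {w : ℂ} (hw : |w.re| ≤ 1) :
    ‖∫ u in Ioo (-a) a, cexp (w * u)‖ ≤ 2 * a * Real.exp a := by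
  have hmeas : volume (Ioo (-a) a) < ⊤ := by simp
  have h := norm_setIntegral_le_of_norm_le_const hmeas
    (f := fun u : ℝ ↦ cexp (w * u)) (C := Real.exp a) (fun u hu ↦ ?_)
  · rw [measureReal_def, Real.volume_Ioo] at h
    have h2 : (a - -a) = 2 * a := by ring
    rw [h2, ENNReal.toReal_ofReal (by linarith)] at h
    linarith [h]
  · rw [Complex.norm_exp, Real.exp_le_exp, Complex.re_mul_ofReal]
    calc w.re * u ≤ |w.re * u| := le_abs_self _
      _ = |w.re| * |u| := abs_mul _ _
      _ ≤ 1 * a := by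
          refine mul_le_mul hw ?_ (abs_nonneg _) zero_le_one
          rw [abs_le]; constructor <;> linarith [hu.1, hu.2]
      _ = a := one_mul a

/-- The window integral of `e^{wu}` is at most `2e^{a}/|Im w|` in norm when `|Re w| ≤ 1` and
`Im w ≠ 0` (explicit primitive). [folklore] -/
private theorem norm_setIntegral_cexp_le_div (ha : 0 < a) {w : ℂ} (hw : |w.re| ≤ 1) (hw0 : w.im ≠ 0) :
    ‖∫ u in Ioo (-a) a, cexp (w * u)‖ ≤ 2 * Real.exp a / |w.im| := by
  have hwne : w ≠ 0 := fun h ↦ hw0 (by rw [h]; simp)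
  have h1 : ∫ u in Ioo (-a) a, cexp (w * u) = ∫ u in (-a)..a, cexp (w * u) := by
    rw [intervalIntegral.integral_of_le (by linarith), integral_Ioc_eq_integral_Ioo]
  rw [h1, integral_exp_mul_complex hwne, norm_div]
  have hnum : ‖cexp (w * (a : ℝ)) - cexp (w * (-a : ℝ))‖ ≤ 2 * Real.exp a := by
    refine (norm_sub_le _ _).trans ?_
    have hb : ∀ s : ℝ, |s| ≤ a → ‖cexp (w * s)‖ ≤ Real.exp a := by
      intro s hs
      rw [Complex.norm_exp, Real.exp_le_exp, Complex.re_mul_ofReal]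
      calc w.re * s ≤ |w.re * s| := le_abs_self _
        _ = |w.re| * |s| := abs_mul _ _
        _ ≤ 1 * a := mul_le_mul hw hs (abs_nonneg _) zero_le_one
        _ = a := one_mul a
    have e1 := hb a (by rw [abs_of_pos ha])
    have e2 := hb (-a) (by rw [abs_neg, abs_of_pos ha])
    push_cast at e1 e2 ⊢
    linarith
  have hden : |w.im| ≤ ‖w‖ := Complex.abs_im_le_norm w
  have hpos : 0 < |w.im| := abs_pos.2 hw0
  calc ‖cexp (w * (a : ℝ)) - cexp (w * (-a : ℝ))‖ / ‖w‖
      ≤ 2 * Real.exp a / ‖w‖ := by gcongr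
    _ ≤ 2 * Real.exp a / |w.im| := by
        gcongr

/-- **Gram bound.** For `|Re z|, |Re z'| ≤ ½`:
`|⟪e z, e z'⟫| ≤ 4 e^{a} max(a,1) / (1 + |Im z' − Im z|)`. [folklore] -/
private theorem norm_inner_expVec_le (ha : 0 < a)
    (he : ∀ z, (e z : ℝ → ℂ) =ᵐ[volume.restrict (Ioo (-a) a)] fun u ↦ cexp (z * u))
    {z z' : ℂ} (hz : |z.re| ≤ 1 / 2) (hz' : |z'.re| ≤ 1 / 2) :
    ‖⟪e z, e z'⟫_ℂ‖ ≤ 4 * Real.exp a * max a 1 / (1 + |z'.im - z.im|) := by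
  rw [inner_expVec_expVec e he]
  set w : ℂ := conj z + z' with hw_def
  have hw : |w.re| ≤ 1 := by
    rw [hw_def, add_re, conj_re]
    calc |z.re + z'.re| ≤ |z.re| + |z'.re| := abs_add_le _ _
      _ ≤ 1 / 2 + 1 / 2 := add_le_add hz hz'
      _ = 1 := by norm_num
  have hwim : w.im = z'.im - z.im := by rw [hw_def, add_im, conj_im]; ring
  set d : ℝ := |z'.im - z.im| with hd
  have hd0 : 0 ≤ d := abs_nonneg _
  have hM : 1 ≤ max a 1 := le_max_right _ _
  have hMa : a ≤ max a 1 := le_max_left _ _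
  have hexp : 0 < Real.exp a := Real.exp_pos a
  by_cases hd1 : d ≤ 1
  · -- trivial bound `2a e^a ≤ 4 e^a max(a,1)/(1+d)` as `1 + d ≤ 2`
    have h := norm_setIntegral_cexp_le ha hw
    rw [le_div_iff₀ (by linarith)]
    calc ‖∫ u in Ioo (-a) a, cexp (w * u)‖ * (1 + d) ≤ (2 * a * Real.exp a) * 2 := by
          refine mul_le_mul h (by linarith) (by linarith) (by positivity)
      _ = 4 * Real.exp a * a := by ring
      _ ≤ 4 * Real.exp a * max a 1 := by gcongr
  · rw [not_le] at hd1
    have hne : w.im ≠ 0 := by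
      rw [hwim]; intro h0; rw [hd, h0, abs_zero] at hd1; linarith
    have h := norm_setIntegral_cexp_le_div ha hw hne
    rw [hwim, ← hd] at h
    have hdpos : 0 < d := by linarith
    rw [le_div_iff₀ (by linarith)]
    calc ‖∫ u in Ioo (-a) a, cexp (w * u)‖ * (1 + d) ≤ (2 * Real.exp a / d) * (1 + d) := by
          gcongr
      _ = 2 * Real.exp a * ((1 + d) / d) := by ring
      _ ≤ 2 * Real.exp a * 2 := by
          gcongr
          rw [div_le_iff₀ hdpos]; linarith
      _ = 4 * Real.exp a * 1 := by ring
      _ ≤ 4 * Real.exp a * max a 1 := by gcongr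

/-- **Norm bound** `‖e z‖² ≤ 2a e^{a}` for `|Re z| ≤ ½`. [folklore] -/
private theorem norm_expVec_sq_le (ha : 0 < a)
    (he : ∀ z, (e z : ℝ → ℂ) =ᵐ[volume.restrict (Ioo (-a) a)] fun u ↦ cexp (z * u))
    {z : ℂ} (hz : |z.re| ≤ 1 / 2) : ‖e z‖ ^ 2 ≤ 2 * a * Real.exp a := by
  have h1 : (‖e z‖ ^ 2 : ℝ) = ‖⟪e z, e z⟫_ℂ‖ := by
    rw [inner_self_eq_norm_sq_to_K, norm_pow]; simp
  rw [h1, inner_expVec_expVec e he]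
  refine norm_setIntegral_cexp_le ha ?_
  rw [add_re, conj_re]
  calc |z.re + z.re| ≤ |z.re| + |z.re| := abs_add_le _ _
    _ ≤ 1 / 2 + 1 / 2 := add_le_add hz hz
    _ = 1 := by norm_num

end Window

/-! ## D. `𝖦_g[a]` maps `L²(−a,a)` to `L²(−a,a)`; its pairing is the form `⟨·,·⟩_{G_g,a}` -/

section ScrewOp

variable {a : ℝ}

/-- Joint continuity of `G_g`. [folklore] -/
private theorem continuous_zetaScrewKernel_uncurry :
    Continuous fun z : ℝ × ℝ ↦ zetaScrewKernel z.1 z.2 := by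
  unfold zetaScrewKernel
  exact ((continuous_zetaScrew.comp continuous_fst).add
    (continuous_zetaScrew.comp continuous_snd)).sub
      (continuous_zetaScrew.comp (continuous_fst.sub continuous_snd))

/-- A uniform bound for `|G_g|` on the square `[−a,a]²`. [folklore] -/
private theorem exists_kernel_bound (a : ℝ) :
    ∃ C : ℝ, 0 ≤ C ∧ ∀ t ∈ Icc (-a) a, ∀ u ∈ Icc (-a) a, ‖(zetaScrewKernel t u : ℂ)‖ ≤ C := by
  obtain ⟨C, hC⟩ := (isCompact_Icc.prod isCompact_Icc).exists_bound_of_continuousOn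
    (continuous_ofReal.comp continuous_zetaScrewKernel_uncurry).continuousOn
      (s := Icc (-a) a ×ˢ Icc (-a) a)
  refine ⟨max C 0, le_max_right _ _, fun t ht u hu ↦ ?_⟩
  exact (hC (t, u) ⟨ht, hu⟩).trans (le_max_left _ _)

/-- `𝖦_g[a]φ` is strongly measurable for `φ ∈ L²(−a,a)`. [folklore] -/
private theorem stronglyMeasurable_zetaScrewOp (φ : Lp ℂ 2 (volume.restrict (Ioo (-a) a))) :
    StronglyMeasurable (zetaScrewOp (Ioo (-a) a) φ) := by
  have hF : StronglyMeasurable (fun z : ℝ × ℝ ↦ (zetaScrewKernel z.1 z.2 : ℂ) * (φ : ℝ → ℂ) z.2) :=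
    (continuous_ofReal.comp continuous_zetaScrewKernel_uncurry).stronglyMeasurable.mul
      ((Lp.stronglyMeasurable φ).comp_measurable measurable_snd)
  have h := hF.integral_prod_right' (ν := volume.restrict (Ioo (-a) a))
  exact h.indicator measurableSet_Ioo

/-- `|𝖦_g[a]φ(t)| ≤ sup|G_g| · ‖φ‖₁`. [folklore] -/
private theorem norm_zetaScrewOp_le (φ : Lp ℂ 2 (volume.restrict (Ioo (-a) a))) {C : ℝ}
    (hC0 : 0 ≤ C) (hC : ∀ t ∈ Icc (-a) a, ∀ u ∈ Icc (-a) a, ‖(zetaScrewKernel t u : ℂ)‖ ≤ C)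
    (t : ℝ) :
    ‖zetaScrewOp (Ioo (-a) a) φ t‖ ≤ C * ∫ u, ‖(φ : ℝ → ℂ) u‖ ∂(volume.restrict (Ioo (-a) a)) := by
  have hφ : Integrable (φ : ℝ → ℂ) (volume.restrict (Ioo (-a) a)) :=
    (Lp.memLp φ).integrable one_le_two
  by_cases ht : t ∈ Ioo (-a) a
  · rw [zetaScrewOp_apply_of_mem ht]
    have hbd : ∀ᵐ u ∂(volume.restrict (Ioo (-a) a)), ‖(zetaScrewKernel t u : ℂ)‖ ≤ C :=
      (ae_restrict_mem measurableSet_Ioo).mono fun u hu ↦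
        hC t (Ioo_subset_Icc_self ht) u (Ioo_subset_Icc_self hu)
    have hGm : AEStronglyMeasurable (fun u ↦ (zetaScrewKernel t u : ℂ))
        (volume.restrict (Ioo (-a) a)) :=
      (continuous_ofReal.comp (continuous_zetaScrewKernel_uncurry.comp
        (Continuous.prodMk_right t))).aestronglyMeasurable
    have hint : Integrable (fun u ↦ (zetaScrewKernel t u : ℂ) * (φ : ℝ → ℂ) u)
        (volume.restrict (Ioo (-a) a)) := hφ.bdd_mul hGm hbd
    calc ‖∫ u in Ioo (-a) a, (zetaScrewKernel t u : ℂ) * (φ : ℝ → ℂ) u‖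
        ≤ ∫ u in Ioo (-a) a, ‖(zetaScrewKernel t u : ℂ) * (φ : ℝ → ℂ) u‖ :=
          norm_integral_le_integral_norm _
      _ ≤ ∫ u in Ioo (-a) a, C * ‖(φ : ℝ → ℂ) u‖ := by
          refine integral_mono_ae hint.norm (hφ.norm.const_mul C) (hbd.mono fun u hu ↦ ?_)
          dsimp only
          rw [norm_mul]
          exact mul_le_mul_of_nonneg_right hu (norm_nonneg _)
      _ = C * ∫ u, ‖(φ : ℝ → ℂ) u‖ ∂(volume.restrict (Ioo (-a) a)) := integral_const_mul _ _
  · rw [zetaScrewOp_apply_of_not_mem ht, norm_zero]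
    exact mul_nonneg hC0 (integral_nonneg fun _ ↦ norm_nonneg _)

/-- `𝖦_g[a]φ ∈ L²(−a,a)` for `φ ∈ L²(−a,a)` ("the integral operator `𝖦_g[a] : L²(−a,a) → L²(−a,a)`";
indeed `𝖦_g[a]φ` is bounded by `sup|G_g|·‖φ‖₁`). [cite: Suzuki2023, Thm 1.4 eq. (1.12), p. 3; §5 p. 15] -/
theorem memLp_zetaScrewOp (φ : Lp ℂ 2 (volume.restrict (Ioo (-a) a))) :
    MemLp (zetaScrewOp (Ioo (-a) a) φ) 2 (volume.restrict (Ioo (-a) a)) := by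
  obtain ⟨C, hC0, hC⟩ := exists_kernel_bound a
  exact MemLp.of_bound (stronglyMeasurable_zetaScrewOp φ).aestronglyMeasurable _
    (Eventually.of_forall (norm_zetaScrewOp_le φ hC0 hC))

/-- `⟨φ, ψ⟩_{G_g,a} = ⟪ψ, 𝖦_g[a]φ⟫_{L²(−a,a)}` for `φ, ψ ∈ L²(−a,a)`. [cite: Suzuki2023, §5 p. 15 ("since ⟨φ₁,φ₂⟩_{G_g,a} = ⟨𝖦_g[a]φ₁,φ₂⟩")] -/
theorem zetaScrewForm_eq_inner (φ ψ : Lp ℂ 2 (volume.restrict (Ioo (-a) a))) :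
    zetaScrewForm (Ioo (-a) a) φ ψ = ⟪ψ, (memLp_zetaScrewOp φ).toLp _⟫_ℂ := by
  rw [zetaScrewForm_eq_integral_zetaScrewOp measurableSet_Ioo, MeasureTheory.L2.inner_def]
  refine integral_congr_ae ((MemLp.coeFn_toLp (memLp_zetaScrewOp φ)).mono fun t ht ↦ ?_)
  dsimp only
  rw [ht, RCLike.inner_apply, mul_comm]

end ScrewOp


/-! ## E. Real-variable inequalities -/

section RealIneq

/-- `1 ≤ log(x + 4)` for `x ≥ 0`. [folklore] -/
private theorem one_le_log_add_four {x : ℝ} (hx : 0 ≤ x) : 1 ≤ Real.log (x + 4) := by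
  rw [Real.le_log_iff_exp_le (by positivity)]
  linarith [Real.exp_one_lt_d9]

/-- `log x ≤ 4 · √(√x)` for `x > 0` (from `log t ≤ t − 1` at `t = x^{1/4}`). [folklore] -/
private theorem log_le_four_mul_sqrt_sqrt {x : ℝ} (hx : 0 < x) :
    Real.log x ≤ 4 * Real.sqrt (Real.sqrt x) := by
  have h1 : Real.log (Real.sqrt (Real.sqrt x)) = Real.log x / 4 := by
    rw [Real.log_sqrt (Real.sqrt_nonneg _), Real.log_sqrt hx.le]; ring
  have hpos : 0 < Real.sqrt (Real.sqrt x) := Real.sqrt_pos.2 (Real.sqrt_pos.2 hx)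
  have h2 := Real.log_le_sub_one_of_pos hpos
  rw [h1] at h2
  linarith

/-- `log(x + 4)² ≤ 36 √x` for `x ≥ 1`. [folklore] -/
private theorem log_add_four_sq_le {x : ℝ} (hx : 1 ≤ x) : Real.log (x + 4) ^ 2 ≤ 36 * Real.sqrt x := by
  have hL0 : 0 ≤ Real.log (x + 4) := zero_le_one.trans (one_le_log_add_four (by linarith))
  have h1 := log_le_four_mul_sqrt_sqrt (show (0 : ℝ) < x + 4 by linarith)
  have h2 : Real.log (x + 4) ^ 2 ≤ (4 * Real.sqrt (Real.sqrt (x + 4))) ^ 2 :=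
    pow_le_pow_left₀ hL0 h1 2
  have h3 : (4 * Real.sqrt (Real.sqrt (x + 4))) ^ 2 = 16 * Real.sqrt (x + 4) := by
    rw [mul_pow, Real.sq_sqrt (Real.sqrt_nonneg _)]; norm_num
  have h4 : Real.sqrt (x + 4) ≤ Real.sqrt (5 * x) := Real.sqrt_le_sqrt (by linarith)
  have h5 : Real.sqrt (5 * x) = Real.sqrt 5 * Real.sqrt x := Real.sqrt_mul (by norm_num) x
  have h6 : Real.sqrt 5 ≤ 9 / 4 := by
    rw [Real.sqrt_le_left (by norm_num)]; norm_num
  have hsx : 0 ≤ Real.sqrt x := Real.sqrt_nonneg x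
  calc Real.log (x + 4) ^ 2 ≤ 16 * Real.sqrt (x + 4) := h2.trans h3.le
    _ ≤ 16 * (Real.sqrt 5 * Real.sqrt x) := by rw [← h5]; gcongr
    _ ≤ 16 * (9 / 4 * Real.sqrt x) := by gcongr
    _ = 36 * Real.sqrt x := by ring

/-- `x^{3/2} = x √x` for `x ≥ 0`. [folklore] -/
private theorem rpow_three_halves_eq {x : ℝ} (hx : 0 ≤ x) : x ^ (3 / 2 : ℝ) = x * Real.sqrt x := by
  have : (3 / 2 : ℝ) = 1 + 1 / 2 := by norm_num
  rw [this, Real.rpow_add' hx (by norm_num), Real.rpow_one, Real.sqrt_eq_rpow]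

/-- The harmonic bound `Σ_{j < K+1} 1/(1+j) ≤ 1 + log(K+1)`. [folklore] -/
private theorem sum_range_inv_one_add_le (K : ℕ) :
    ∑ j ∈ Finset.range (K + 1), (1 : ℝ) / (1 + j) ≤ 1 + Real.log (K + 1) := by
  have h := harmonic_le_one_add_log (K + 1)
  have hh : ((harmonic (K + 1) : ℚ) : ℝ) = ∑ j ∈ Finset.range (K + 1), (1 : ℝ) / (1 + j) := by
    rw [harmonic]
    push_cast
    refine Finset.sum_congr rfl fun j _ ↦ ?_
    rw [one_div, add_comm]
  rw [hh] at h
  exact_mod_cast h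

end RealIneq

/-! ## F. The Schur row sums over the zeros (the key estimate) -/

section KeyEstimate

/-- FAR RANGE: if `|y − γ| > |y|/2` with `|γ|, |y| > N ≥ 1` and `γ² ≤ κ₂`, then
`(m/κ₂)/(1 + |y − γ|) ≤ (2/(N√N)) · m/(|γ|√|γ|)`. [folklore] -/
private theorem far_bound {N : ℕ} (hN : 1 ≤ N) {y γ m κ₂ : ℝ} (hy : (N : ℝ) < |y|) (hγ : (N : ℝ) < |γ|)
    (hfar : |y| / 2 < |y - γ|) (hm : 0 ≤ m) (hκ : γ ^ 2 ≤ κ₂) :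
    m / κ₂ * (1 / (1 + |y - γ|)) ≤ 2 / ((N : ℝ) * Real.sqrt N) * (m / (|γ| * Real.sqrt |γ|)) := by
  have hN1 : (1 : ℝ) ≤ N := by exact_mod_cast hN
  have hNpos : (0 : ℝ) < N := by linarith
  have hγpos : 0 < |γ| := by linarith
  have hypos : 0 < |y| := by linarith
  have hγ2 : 0 < γ ^ 2 := by rw [← sq_abs]; positivity
  have hκpos : 0 < κ₂ := lt_of_lt_of_le hγ2 hκ
  -- `m/κ₂ ≤ m/γ²`
  have h1 : m / κ₂ ≤ m / γ ^ 2 := div_le_div_of_nonneg_left hm hγ2 hκ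
  -- `1/(1+|y-γ|) ≤ 2/N`
  have h2 : 1 / (1 + |y - γ|) ≤ 2 / N := by
    rw [div_le_div_iff₀ (by positivity) hNpos]
    nlinarith
  -- `γ² ≥ √N · |γ| · √|γ|`
  have hsq : Real.sqrt N ≤ Real.sqrt |γ| := Real.sqrt_le_sqrt hγ.le
  have h3 : Real.sqrt N * (|γ| * Real.sqrt |γ|) ≤ γ ^ 2 := by
    rw [← sq_abs]
    calc Real.sqrt N * (|γ| * Real.sqrt |γ|) ≤ Real.sqrt |γ| * (|γ| * Real.sqrt |γ|) := by
          gcongr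
      _ = |γ| * (Real.sqrt |γ| * Real.sqrt |γ|) := by ring
      _ = |γ| ^ 2 := by rw [Real.mul_self_sqrt hγpos.le, sq]
  have hden : 0 < Real.sqrt N * (|γ| * Real.sqrt |γ|) := by positivity
  have h4 : m / γ ^ 2 ≤ m / (Real.sqrt N * (|γ| * Real.sqrt |γ|)) :=
    div_le_div_of_nonneg_left hm hden h3
  calc m / κ₂ * (1 / (1 + |y - γ|)) ≤ m / γ ^ 2 * (2 / N) :=
        mul_le_mul h1 h2 (by positivity) (by positivity)
    _ ≤ m / (Real.sqrt N * (|γ| * Real.sqrt |γ|)) * (2 / N) := by gcongr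
    _ = 2 / ((N : ℝ) * Real.sqrt N) * (m / (|γ| * Real.sqrt |γ|)) := by
        field_simp

/-- NEAR RANGE: if `|y − γ| ≤ |y|/2`, `γ² ≤ κ₂`, `0 < |y|`, then with `K = ⌊|y|/2⌋₊ + 1`,
`(m/κ₂)/(1 + |y − γ|) ≤ (15/2)/y² · [Σ_{j ≤ K} (m/(1+j))/(1 + (γ − (y+j))²) + Σ_{j ≤ K} (m/(1+j))/(1 + (γ − (y−j))²)]`
(the nearest integer `k₀` to `γ − y` carries the term). [folklore] -/
private theorem near_bound {y γ m κ₂ : ℝ} (hy : 0 < |y|) (hnear : |y - γ| ≤ |y| / 2) (hm : 0 ≤ m)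
    (hκ : γ ^ 2 ≤ κ₂) :
    m / κ₂ * (1 / (1 + |y - γ|)) ≤ (15 / 2) / y ^ 2 *
      (∑ j ∈ Finset.range (⌊|y| / 2⌋₊ + 1 + 1), 1 / (1 + (j : ℝ)) * (m / (1 + (γ - (y + j)) ^ 2)) +
        ∑ j ∈ Finset.range (⌊|y| / 2⌋₊ + 1 + 1), 1 / (1 + (j : ℝ)) * (m / (1 + (γ - (y - j)) ^ 2))) := by
  set K : ℕ := ⌊|y| / 2⌋₊ + 1 with hK
  set d : ℝ := |y - γ| with hd
  have hd0 : 0 ≤ d := abs_nonneg _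
  have hy2 : 0 < y ^ 2 := by rw [← sq_abs]; positivity
  -- `|γ| ≥ |y|/2`, so `γ² ≥ y²/4`
  have hγ : |y| / 2 ≤ |γ| := by
    have := abs_sub_abs_le_abs_sub y γ
    linarith
  have hγpos : 0 < |γ| := by linarith
  have hγ2 : y ^ 2 / 4 ≤ γ ^ 2 := by
    rw [← sq_abs y, ← sq_abs γ]; nlinarith [abs_nonneg y]
  have hγ2pos : 0 < γ ^ 2 := by linarith [hy2]
  have hκpos : 0 < κ₂ := lt_of_lt_of_le hγ2pos hκ
  have h1 : m / κ₂ ≤ 4 * m / y ^ 2 := by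
    calc m / κ₂ ≤ m / (y ^ 2 / 4) := div_le_div_of_nonneg_left hm (by positivity) (hγ2.trans hκ)
      _ = 4 * m / y ^ 2 := by field_simp
  -- the nearest integer
  set k₀ : ℤ := round (γ - y) with hk₀
  have hround : |γ - y - k₀| ≤ 1 / 2 := abs_sub_round (γ - y)
  have hk₀abs : (|k₀| : ℝ) ≤ d + 1 / 2 := by
    rw [hd, abs_sub_comm y γ]
    have : |(k₀ : ℝ)| ≤ |γ - y| + |γ - y - k₀| := by
      have e : (k₀ : ℝ) = (γ - y) - (γ - y - k₀) := by ring
      calc |(k₀ : ℝ)| = |(γ - y) - (γ - y - k₀)| := by rw [← e]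
        _ ≤ |γ - y| + |γ - y - k₀| := abs_sub _ _
    linarith
  -- the term carried by `k₀`
  have hterm : 4 * m / y ^ 2 * (1 / (1 + d)) ≤
      (15 / 2) / y ^ 2 * (1 / (1 + (|k₀| : ℝ)) * (m / (1 + (γ - y - k₀) ^ 2))) := by
    have hsq : (γ - y - k₀) ^ 2 ≤ 1 / 4 := by
      rw [← sq_abs]; nlinarith [abs_nonneg (γ - y - (k₀ : ℝ))]
    have hA : m / (5 / 4) ≤ m / (1 + (γ - y - k₀) ^ 2) :=
      div_le_div_of_nonneg_left hm (by positivity) (by linarith)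
    have hB : 1 / (3 / 2 + d) ≤ 1 / (1 + (|k₀| : ℝ)) :=
      div_le_div_of_nonneg_left zero_le_one (by positivity) (by linarith)
    have hmy : 0 ≤ m / y ^ 2 := by positivity
    calc 4 * m / y ^ 2 * (1 / (1 + d)) = m / y ^ 2 * (4 / (1 + d)) := by ring
      _ ≤ m / y ^ 2 * (6 / (3 / 2 + d)) := by
          refine mul_le_mul_of_nonneg_left ?_ hmy
          rw [div_le_div_iff₀ (by positivity) (by positivity)]; nlinarith
      _ = (15 / 2) / y ^ 2 * (1 / (3 / 2 + d) * (m / (5 / 4))) := by ring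
      _ ≤ (15 / 2) / y ^ 2 * (1 / (1 + (|k₀| : ℝ)) * (m / (1 + (γ - y - k₀) ^ 2))) := by
          refine mul_le_mul_of_nonneg_left ?_ (by positivity)
          exact mul_le_mul hB hA (by positivity) (by positivity)
  -- `|k₀| ≤ K`
  have hk₀K : |k₀| ≤ (K : ℤ) := by
    have hlt : (|k₀| : ℝ) < (K : ℝ) + 1 := by
      have hfl : |y| / 2 < (⌊|y| / 2⌋₊ : ℝ) + 1 := Nat.lt_floor_add_one _
      have : (K : ℝ) = (⌊|y| / 2⌋₊ : ℝ) + 1 := by rw [hK]; push_cast; ring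
      rw [this]
      have hdle : d ≤ |y| / 2 := hnear
      linarith
    have hlt' : |k₀| < (K : ℤ) + 1 := by exact_mod_cast hlt
    omega
  have htot : m / κ₂ * (1 / (1 + d)) ≤
      (15 / 2) / y ^ 2 * (1 / (1 + (|k₀| : ℝ)) * (m / (1 + (γ - y - k₀) ^ 2))) :=
    (mul_le_mul_of_nonneg_right h1 (by positivity)).trans hterm
  -- place the `k₀`-term in one of the two sums
  have hnonneg₁ : ∀ j ∈ Finset.range (K + 1), (0 : ℝ) ≤ 1 / (1 + (j : ℝ)) * (m / (1 + (γ - (y + j)) ^ 2)) :=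
    fun j _ ↦ by positivity
  have hnonneg₂ : ∀ j ∈ Finset.range (K + 1), (0 : ℝ) ≤ 1 / (1 + (j : ℝ)) * (m / (1 + (γ - (y - j)) ^ 2)) :=
    fun j _ ↦ by positivity
  have hS₁ : 0 ≤ ∑ j ∈ Finset.range (K + 1), 1 / (1 + (j : ℝ)) * (m / (1 + (γ - (y + j)) ^ 2)) :=
    Finset.sum_nonneg hnonneg₁
  have hS₂ : 0 ≤ ∑ j ∈ Finset.range (K + 1), 1 / (1 + (j : ℝ)) * (m / (1 + (γ - (y - j)) ^ 2)) :=
    Finset.sum_nonneg hnonneg₂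
  rcases le_or_gt 0 k₀ with hk | hk
  · -- `k₀ = j₀ ≥ 0`: first sum
    set j₀ : ℕ := k₀.toNat with hj₀
    have hj₀eq : (k₀ : ℝ) = (j₀ : ℝ) := by
      have : (j₀ : ℤ) = k₀ := Int.toNat_of_nonneg hk
      exact_mod_cast this.symm
    have hj₀abs : (|k₀| : ℝ) = (j₀ : ℝ) := by
      rw [← hj₀eq]; exact abs_of_nonneg (by exact_mod_cast hk)
    have hj₀mem : j₀ ∈ Finset.range (K + 1) := by
      rw [Finset.mem_range]
      have : (j₀ : ℤ) ≤ K := by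
        rw [Int.toNat_of_nonneg hk]; exact (le_abs_self k₀).trans hk₀K
      omega
    have hsingle := Finset.single_le_sum hnonneg₁ hj₀mem
    have hkey : 1 / (1 + (|k₀| : ℝ)) * (m / (1 + (γ - y - k₀) ^ 2)) =
        1 / (1 + (j₀ : ℝ)) * (m / (1 + (γ - (y + j₀)) ^ 2)) := by
      rw [hj₀abs, hj₀eq]; ring_nf
    calc m / κ₂ * (1 / (1 + d)) ≤ (15 / 2) / y ^ 2 * (1 / (1 + (|k₀| : ℝ)) * (m / (1 + (γ - y - k₀) ^ 2))) := htot
      _ ≤ (15 / 2) / y ^ 2 * (∑ j ∈ Finset.range (K + 1), 1 / (1 + (j : ℝ)) * (m / (1 + (γ - (y + j)) ^ 2)) +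
            ∑ j ∈ Finset.range (K + 1), 1 / (1 + (j : ℝ)) * (m / (1 + (γ - (y - j)) ^ 2))) := by
          rw [hkey]
          gcongr
          linarith [hsingle]
  · -- `k₀ = -j₀ < 0`: second sum
    set j₀ : ℕ := (-k₀).toNat with hj₀
    have hj₀eq : (k₀ : ℝ) = -(j₀ : ℝ) := by
      have : (j₀ : ℤ) = -k₀ := Int.toNat_of_nonneg (by omega)
      have : k₀ = -(j₀ : ℤ) := by omega
      exact_mod_cast this
    have hj₀abs : (|k₀| : ℝ) = (j₀ : ℝ) := by
      have : |k₀| = (j₀ : ℤ) := by rw [Int.toNat_of_nonneg (by omega)]; exact abs_of_neg hk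
      exact_mod_cast this
    have hj₀mem : j₀ ∈ Finset.range (K + 1) := by
      rw [Finset.mem_range]
      have : (j₀ : ℤ) ≤ K := by
        rw [Int.toNat_of_nonneg (by omega)]; exact (neg_le_abs k₀).trans hk₀K
      omega
    have hsingle := Finset.single_le_sum hnonneg₂ hj₀mem
    have hkey : 1 / (1 + (|k₀| : ℝ)) * (m / (1 + (γ - y - k₀) ^ 2)) =
        1 / (1 + (j₀ : ℝ)) * (m / (1 + (γ - (y - j₀)) ^ 2)) := by
      rw [hj₀abs, hj₀eq]; ring_nf
    calc m / κ₂ * (1 / (1 + d)) ≤ (15 / 2) / y ^ 2 * (1 / (1 + (|k₀| : ℝ)) * (m / (1 + (γ - y - k₀) ^ 2))) := htot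
      _ ≤ (15 / 2) / y ^ 2 * (∑ j ∈ Finset.range (K + 1), 1 / (1 + (j : ℝ)) * (m / (1 + (γ - (y + j)) ^ 2)) +
            ∑ j ∈ Finset.range (K + 1), 1 / (1 + (j : ℝ)) * (m / (1 + (γ - (y - j)) ^ 2))) := by
          rw [hkey]
          gcongr
          linarith [hsingle]

end KeyEstimate


/-! ## F. The Schur row sums over the zeros -/

section Zeros

/-- **Key estimate.** Uniformly for `|y| > N ≥ 1`:
`Σ_{ρ : |γ| > N} (m(ρ)/|ρ − ½|²) / (1 + |y − γ|) ≤ C/(N√N)` (unit-window zero density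
`Σ_ρ m(ρ)/(1 + (γ − t)²) ≪ log(|t|+4)` at the shifted centres `t = y ± j`, `j ≤ |y|/2 + 1`, with
harmonic weights, plus `Σ_ρ m(ρ)/|γ|^{3/2} < ∞` for the far zeros). [cite: MontgomeryVaughan2007, Theorem 10.13 and Lemma 12.1] -/
private theorem key_estimate : ∃ C : ℝ, 0 < C ∧ ∀ N : ℕ, 1 ≤ N → ∀ y : ℝ, (N : ℝ) < |y| →
    Summable (fun ρ : ZetaZeros.riemannZetaNontrivialZeros ↦
      if (N : ℝ) < |(ρ : ℂ).im| then
        (riemannZetaZeroOrder (ρ : ℂ) : ℝ) / ‖(ρ : ℂ) - 1 / 2‖ ^ 2 * (1 / (1 + |y - (ρ : ℂ).im|))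
      else 0) ∧
    ∑' ρ : ZetaZeros.riemannZetaNontrivialZeros,
      (if (N : ℝ) < |(ρ : ℂ).im| then
        (riemannZetaZeroOrder (ρ : ℂ) : ℝ) / ‖(ρ : ℂ) - 1 / 2‖ ^ 2 * (1 / (1 + |y - (ρ : ℂ).im|))
      else 0) ≤ C / ((N : ℝ) * Real.sqrt N) := by
  obtain ⟨C_T, hC_T0, hT⟩ := ZetaZeroSum.exists_tsum_zeroOrder_div_sq_le
  -- shorthand
  set m : ZetaZeros.riemannZetaNontrivialZeros → ℝ := fun ρ ↦ (riemannZetaZeroOrder (ρ : ℂ) : ℝ)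
    with hm_def
  set γ : ZetaZeros.riemannZetaNontrivialZeros → ℝ := fun ρ ↦ (ρ : ℂ).im with hγ_def
  have hm0 : ∀ ρ, 0 ≤ m ρ := fun ρ ↦ ZetaZeroSum.zeroOrder_nonneg ρ
  -- unit-window density with `c = 1`
  have hT1 : ∀ t : ℝ, Summable (fun ρ : ZetaZeros.riemannZetaNontrivialZeros ↦
      m ρ / (1 + (γ ρ - t) ^ 2)) ∧
      ∑' ρ : ZetaZeros.riemannZetaNontrivialZeros, m ρ / (1 + (γ ρ - t) ^ 2) ≤
        C_T * Real.log (|t| + 4) := by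
    intro t
    obtain ⟨h1, h2⟩ := hT t 1 one_pos le_rfl
    simp only [one_pow, div_one] at h1 h2
    exact ⟨h1, h2⟩
  -- `Σ m/|γ|^{3/2} < ∞`
  have hP : Summable (fun ρ : ZetaZeros.riemannZetaNontrivialZeros ↦
      m ρ / (|γ ρ| * Real.sqrt |γ ρ|)) := by
    have h := ZetaZeroSum.summable_zeroOrder_div_abs_im_rpow (σ := 3 / 2) (by norm_num)
    refine h.congr fun ρ ↦ ?_
    simp only [hm_def, hγ_def, rpow_three_halves_eq (abs_nonneg _)]
  set C₃₂ : ℝ := ∑' ρ : ZetaZeros.riemannZetaNontrivialZeros, m ρ / (|γ ρ| * Real.sqrt |γ ρ|)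
    with hC₃₂
  have hC₃₂0 : 0 ≤ C₃₂ := tsum_nonneg fun ρ ↦ by have := hm0 ρ; positivity
  refine ⟨2 * C₃₂ + 2160 * C_T + 1, by positivity, fun N hN y hy ↦ ?_⟩
  have hN1 : (1 : ℝ) ≤ N := by exact_mod_cast hN
  have hNpos : (0 : ℝ) < N := by linarith
  have hy1 : 1 ≤ |y| := by linarith
  have hypos : 0 < |y| := by linarith
  have hy2 : 0 < y ^ 2 := by rw [← sq_abs]; positivity
  set K : ℕ := ⌊|y| / 2⌋₊ + 1 with hK
  set L : ℝ := Real.log (|y| + 4) with hL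
  have hL1 : 1 ≤ L := one_le_log_add_four (abs_nonneg y)
  -- the dominating family
  set g : ZetaZeros.riemannZetaNontrivialZeros → ℝ := fun ρ ↦
    2 / ((N : ℝ) * Real.sqrt N) * (m ρ / (|γ ρ| * Real.sqrt |γ ρ|)) +
      (15 / 2) / y ^ 2 *
        (∑ j ∈ Finset.range (K + 1), 1 / (1 + (j : ℝ)) * (m ρ / (1 + (γ ρ - (y + j)) ^ 2)) +
          ∑ j ∈ Finset.range (K + 1), 1 / (1 + (j : ℝ)) * (m ρ / (1 + (γ ρ - (y - j)) ^ 2)))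
    with hg
  set f : ZetaZeros.riemannZetaNontrivialZeros → ℝ := fun ρ ↦
    if (N : ℝ) < |(ρ : ℂ).im| then
      (riemannZetaZeroOrder (ρ : ℂ) : ℝ) / ‖(ρ : ℂ) - 1 / 2‖ ^ 2 * (1 / (1 + |y - (ρ : ℂ).im|))
    else 0 with hf
  have hf0 : ∀ ρ, 0 ≤ f ρ := fun ρ ↦ by
    simp only [hf]
    split_ifs
    · have := hm0 ρ; positivity
    · exact le_rfl
  have hg0 : ∀ ρ, 0 ≤ g ρ := fun ρ ↦ by
    have := hm0 ρ
    simp only [hg]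
    refine add_nonneg (by positivity) (mul_nonneg (by positivity) (add_nonneg ?_ ?_)) <;>
      exact Finset.sum_nonneg fun j _ ↦ by positivity
  -- domination
  have hfg : ∀ ρ, f ρ ≤ g ρ := by
    intro ρ
    by_cases htail : (N : ℝ) < |(ρ : ℂ).im|
    · have hκ : γ ρ ^ 2 ≤ ‖(ρ : ℂ) - 1 / 2‖ ^ 2 := by
        have h1 : |((ρ : ℂ) - 1 / 2).im| ≤ ‖(ρ : ℂ) - 1 / 2‖ := Complex.abs_im_le_norm _
        have h2 : ((ρ : ℂ) - 1 / 2).im = γ ρ := by simp [hγ_def]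
        rw [h2] at h1
        rw [← sq_abs (γ ρ)]
        exact pow_le_pow_left₀ (abs_nonneg _) h1 2
      simp only [hf, if_pos htail]
      have hsum0 : 0 ≤ ∑ j ∈ Finset.range (K + 1), 1 / (1 + (j : ℝ)) * (m ρ / (1 + (γ ρ - (y + j)) ^ 2)) +
          ∑ j ∈ Finset.range (K + 1), 1 / (1 + (j : ℝ)) * (m ρ / (1 + (γ ρ - (y - j)) ^ 2)) := by
        have := hm0 ρ
        refine add_nonneg ?_ ?_ <;> exact Finset.sum_nonneg fun j _ ↦ by positivity
      rcases lt_or_ge (|y| / 2) |y - γ ρ| with hfar | hnear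
      · have h := far_bound hN hy htail hfar (hm0 ρ) hκ
        calc _ ≤ 2 / ((N : ℝ) * Real.sqrt N) * (m ρ / (|γ ρ| * Real.sqrt |γ ρ|)) := h
          _ ≤ g ρ := by
              simp only [hg]
              have : 0 ≤ (15 / 2) / y ^ 2 * (∑ j ∈ Finset.range (K + 1), 1 / (1 + (j : ℝ)) *
                  (m ρ / (1 + (γ ρ - (y + j)) ^ 2)) +
                  ∑ j ∈ Finset.range (K + 1), 1 / (1 + (j : ℝ)) * (m ρ / (1 + (γ ρ - (y - j)) ^ 2))) :=
                mul_nonneg (by positivity) hsum0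
              linarith
      · have h := near_bound hypos hnear (hm0 ρ) hκ
        calc _ ≤ _ := h
          _ ≤ g ρ := by
              simp only [hg, hK]
              have := hm0 ρ
              have : 0 ≤ 2 / ((N : ℝ) * Real.sqrt N) * (m ρ / (|γ ρ| * Real.sqrt |γ ρ|)) := by
                positivity
              linarith
    · simp only [hf, if_neg htail]
      exact hg0 ρ
  -- the sum of `g`
  have hg_hasSum : HasSum g (2 / ((N : ℝ) * Real.sqrt N) * C₃₂ + (15 / 2) / y ^ 2 *
      (∑ j ∈ Finset.range (K + 1), 1 / (1 + (j : ℝ)) *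
          ∑' ρ : ZetaZeros.riemannZetaNontrivialZeros, m ρ / (1 + (γ ρ - (y + j)) ^ 2) +
        ∑ j ∈ Finset.range (K + 1), 1 / (1 + (j : ℝ)) *
          ∑' ρ : ZetaZeros.riemannZetaNontrivialZeros, m ρ / (1 + (γ ρ - (y - j)) ^ 2))) := by
    have hA : HasSum (fun ρ : ZetaZeros.riemannZetaNontrivialZeros ↦
        2 / ((N : ℝ) * Real.sqrt N) * (m ρ / (|γ ρ| * Real.sqrt |γ ρ|)))
        (2 / ((N : ℝ) * Real.sqrt N) * C₃₂) := hP.hasSum.mul_left _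
    have hB₁ : HasSum (fun ρ : ZetaZeros.riemannZetaNontrivialZeros ↦
        ∑ j ∈ Finset.range (K + 1), 1 / (1 + (j : ℝ)) * (m ρ / (1 + (γ ρ - (y + j)) ^ 2)))
        (∑ j ∈ Finset.range (K + 1), 1 / (1 + (j : ℝ)) *
          ∑' ρ : ZetaZeros.riemannZetaNontrivialZeros, m ρ / (1 + (γ ρ - (y + j)) ^ 2)) :=
      hasSum_sum fun j _ ↦ (hT1 (y + j)).1.hasSum.mul_left _
    have hB₂ : HasSum (fun ρ : ZetaZeros.riemannZetaNontrivialZeros ↦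
        ∑ j ∈ Finset.range (K + 1), 1 / (1 + (j : ℝ)) * (m ρ / (1 + (γ ρ - (y - j)) ^ 2)))
        (∑ j ∈ Finset.range (K + 1), 1 / (1 + (j : ℝ)) *
          ∑' ρ : ZetaZeros.riemannZetaNontrivialZeros, m ρ / (1 + (γ ρ - (y - j)) ^ 2)) :=
      hasSum_sum fun j _ ↦ (hT1 (y - j)).1.hasSum.mul_left _
    have h := hA.add ((hB₁.add hB₂).mul_left ((15 / 2) / y ^ 2))
    exact h
  have hf_summ : Summable f := Summable.of_nonneg_of_le hf0 hfg hg_hasSum.summable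
  refine ⟨hf_summ, ?_⟩
  -- bounds for the shifted window sums
  have hcentre : ∀ j ∈ Finset.range (K + 1), ∀ s : ℝ, (s = y + j ∨ s = y - j) →
      Real.log (|s| + 4) ≤ 2 * L := by
    intro j hj s hs
    have hjK : (j : ℝ) ≤ K := by
      have := Finset.mem_range.1 hj
      exact_mod_cast Nat.lt_succ_iff.1 this
    have hKle : (K : ℝ) ≤ |y| / 2 + 1 := by
      rw [hK]; push_cast; linarith [Nat.floor_le (by positivity : 0 ≤ |y| / 2)]
    have hs_abs : |s| ≤ |y| + (j : ℝ) := by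
      rcases hs with rfl | rfl
      · calc |y + j| ≤ |y| + |(j : ℝ)| := abs_add_le _ _
          _ = |y| + j := by rw [Nat.abs_cast]
      · calc |y - j| ≤ |y| + |(j : ℝ)| := abs_sub _ _
          _ = |y| + j := by rw [Nat.abs_cast]
    have h1 : |s| + 4 ≤ (|y| + 4) ^ 2 := by nlinarith [abs_nonneg y]
    calc Real.log (|s| + 4) ≤ Real.log ((|y| + 4) ^ 2) :=
          Real.log_le_log (by positivity) h1
      _ = 2 * L := by rw [Real.log_pow]; push_cast; rw [hL]
  have hweights : ∑ j ∈ Finset.range (K + 1), 1 / (1 + (j : ℝ)) ≤ 2 * L := by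
    have h1 := sum_range_inv_one_add_le K
    have h2 : Real.log ((K : ℝ) + 1) ≤ L := by
      refine Real.log_le_log (by positivity) ?_
      have hKle : (K : ℝ) ≤ |y| / 2 + 1 := by
        rw [hK]; push_cast; linarith [Nat.floor_le (by positivity : 0 ≤ |y| / 2)]
      linarith [abs_nonneg y]
    linarith
  have hnear₁ : ∑ j ∈ Finset.range (K + 1), 1 / (1 + (j : ℝ)) *
      ∑' ρ : ZetaZeros.riemannZetaNontrivialZeros, m ρ / (1 + (γ ρ - (y + j)) ^ 2) ≤
        4 * C_T * L ^ 2 := by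
    calc _ ≤ ∑ j ∈ Finset.range (K + 1), 1 / (1 + (j : ℝ)) * (C_T * (2 * L)) := by
          refine Finset.sum_le_sum fun j hj ↦ ?_
          refine mul_le_mul_of_nonneg_left ?_ (by positivity)
          exact ((hT1 (y + j)).2).trans (mul_le_mul_of_nonneg_left (hcentre j hj _ (Or.inl rfl)) hC_T0.le)
      _ = (∑ j ∈ Finset.range (K + 1), 1 / (1 + (j : ℝ))) * (C_T * (2 * L)) := by
          rw [Finset.sum_mul]
      _ ≤ (2 * L) * (C_T * (2 * L)) := by gcongr
      _ = 4 * C_T * L ^ 2 := by ring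
  have hnear₂ : ∑ j ∈ Finset.range (K + 1), 1 / (1 + (j : ℝ)) *
      ∑' ρ : ZetaZeros.riemannZetaNontrivialZeros, m ρ / (1 + (γ ρ - (y - j)) ^ 2) ≤
        4 * C_T * L ^ 2 := by
    calc _ ≤ ∑ j ∈ Finset.range (K + 1), 1 / (1 + (j : ℝ)) * (C_T * (2 * L)) := by
          refine Finset.sum_le_sum fun j hj ↦ ?_
          refine mul_le_mul_of_nonneg_left ?_ (by positivity)
          exact ((hT1 (y - j)).2).trans (mul_le_mul_of_nonneg_left (hcentre j hj _ (Or.inr rfl)) hC_T0.le)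
      _ = (∑ j ∈ Finset.range (K + 1), 1 / (1 + (j : ℝ))) * (C_T * (2 * L)) := by
          rw [Finset.sum_mul]
      _ ≤ (2 * L) * (C_T * (2 * L)) := by gcongr
      _ = 4 * C_T * L ^ 2 := by ring
  -- `L² ≤ 36 √|y|` and `√|y|/y² = 1/(|y|√|y|) ≤ 1/(N√N)`
  have hL2 : L ^ 2 ≤ 36 * Real.sqrt |y| := log_add_four_sq_le hy1
  have hyy : y ^ 2 = |y| * (Real.sqrt |y| * Real.sqrt |y|) := by
    rw [Real.mul_self_sqrt (abs_nonneg _), ← sq_abs, sq]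
  have hNN : (N : ℝ) * Real.sqrt N ≤ |y| * Real.sqrt |y| := by
    have := Real.sqrt_le_sqrt hy.le
    gcongr
  have hNNpos : 0 < (N : ℝ) * Real.sqrt N := by positivity
  calc ∑' ρ, f ρ ≤ ∑' ρ, g ρ := hf_summ.tsum_le_tsum hfg hg_hasSum.summable
    _ = _ := hg_hasSum.tsum_eq
    _ ≤ 2 / ((N : ℝ) * Real.sqrt N) * C₃₂ + (15 / 2) / y ^ 2 * (4 * C_T * L ^ 2 + 4 * C_T * L ^ 2) := by
        gcongr
    _ = 2 * C₃₂ / ((N : ℝ) * Real.sqrt N) + 60 * C_T * (L ^ 2 / y ^ 2) := by ring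
    _ ≤ 2 * C₃₂ / ((N : ℝ) * Real.sqrt N) + 60 * C_T * (36 / (|y| * Real.sqrt |y|)) := by
        gcongr 2 * C₃₂ / ((N : ℝ) * Real.sqrt N) + 60 * C_T * ?_
        rw [div_le_div_iff₀ hy2 (by positivity), hyy]
        calc L ^ 2 * (|y| * Real.sqrt |y|)
            ≤ (36 * Real.sqrt |y|) * (|y| * Real.sqrt |y|) := by gcongr
          _ = 36 * (|y| * (Real.sqrt |y| * Real.sqrt |y|)) := by ring
    _ ≤ 2 * C₃₂ / ((N : ℝ) * Real.sqrt N) + 60 * C_T * (36 / ((N : ℝ) * Real.sqrt N)) := by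
        gcongr 2 * C₃₂ / ((N : ℝ) * Real.sqrt N) + 60 * C_T * ?_
        exact div_le_div_of_nonneg_left (by norm_num) hNNpos hNN
    _ = (2 * C₃₂ + 2160 * C_T) / ((N : ℝ) * Real.sqrt N) := by ring
    _ ≤ (2 * C₃₂ + 2160 * C_T + 1) / ((N : ℝ) * Real.sqrt N) :=
        div_le_div_of_nonneg_right (by linarith) hNNpos.le

/-! ## G. Counting zeros by height -/

/-- Only finitely many non-trivial zeros have `|Im ρ| ≤ R`. [folklore] -/
private theorem finite_abs_im_le (R : ℝ) :
    {ρ : ZetaZeros.riemannZetaNontrivialZeros | |(ρ : ℂ).im| ≤ R}.Finite := by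
  have hK : IsCompact (Set.Icc (0 : ℝ) 1 ×ℂ Set.Icc (-R) R) :=
    (isCompact_Icc (a := (0 : ℝ)) (b := 1)).reProdIm (isCompact_Icc (a := -R) (b := R))
  have hfin := hK.inter_riemannZetaZeros_finite
  have hsub : {ρ : ZetaZeros.riemannZetaNontrivialZeros | |(ρ : ℂ).im| ≤ R} ⊆
      Subtype.val ⁻¹' (Set.Icc (0 : ℝ) 1 ×ℂ Set.Icc (-R) R ∩ riemannZetaZeros) := by
    intro ρ hρ
    have hR : |(ρ : ℂ).im| ≤ R := hρ
    refine ⟨Complex.mem_reProdIm.2 ⟨⟨?_, ?_⟩, ?_⟩, ?_⟩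
    · exact (ZetaZeros.riemannZetaNontrivialZeros.re_pos ρ.2).le
    · exact (ZetaZeros.riemannZetaNontrivialZeros.re_lt_one ρ.2).le
    · exact Set.mem_Icc.2 (abs_le.1 hR)
    · exact ZetaZeros.riemannZetaNontrivialZeros.zeta_eq_zero ρ.2
  exact (hfin.preimage Subtype.val_injective.injOn).subset hsub

/-- The counting sets increase with the height. [folklore] -/
private theorem finite_abs_im_le_mono {R R' : ℝ} (h : R ≤ R') :
    (finite_abs_im_le R).toFinset ⊆ (finite_abs_im_le R').toFinset := by
  intro ρ hρ
  simp only [Set.Finite.mem_toFinset, Set.mem_setOf_eq] at hρ ⊢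
  exact hρ.trans h

/-- **Increments of the zero count**: the number of (distinct) non-trivial zeros with
`N < |γ| ≤ N + 1` is `≤ D log(N + 5)` (each such zero carries weight `≥ 4/5` in one of the two
unit windows centred at `±(N + ½)`, and `m(ρ) ≥ 1`). [cite: MontgomeryVaughan2007, Theorem 10.13] -/
private theorem exists_card_increment_le : ∃ D : ℝ, 0 < D ∧ ∀ N : ℕ,
    (((finite_abs_im_le ((N + 1 : ℕ) : ℝ)).toFinset.card : ℝ)) -
        (finite_abs_im_le (N : ℝ)).toFinset.card ≤ D * Real.log ((N : ℝ) + 5) := by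
  obtain ⟨C_T, hC_T0, hT⟩ := ZetaZeroSum.exists_tsum_zeroOrder_div_sq_le
  refine ⟨5 / 2 * C_T, by positivity, fun N ↦ ?_⟩
  set A := (finite_abs_im_le (N : ℝ)).toFinset with hA
  set B := (finite_abs_im_le ((N + 1 : ℕ) : ℝ)).toFinset with hB
  have hAB : A ⊆ B := finite_abs_im_le_mono (by push_cast; linarith)
  have hcard : ((B.card : ℝ)) - A.card = ((B \ A).card : ℝ) := by
    rw [Finset.card_sdiff_of_subset hAB, Nat.cast_sub (Finset.card_le_card hAB)]
  rw [hcard]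
  -- weights
  set t : ℝ := (N : ℝ) + 1 / 2 with ht
  set gp : ZetaZeros.riemannZetaNontrivialZeros → ℝ := fun ρ ↦
    (riemannZetaZeroOrder (ρ : ℂ) : ℝ) / (1 + ((ρ : ℂ).im - t) ^ 2) with hgp
  set gm : ZetaZeros.riemannZetaNontrivialZeros → ℝ := fun ρ ↦
    (riemannZetaZeroOrder (ρ : ℂ) : ℝ) / (1 + ((ρ : ℂ).im - (-t)) ^ 2) with hgm
  have hTp := hT t 1 one_pos le_rfl
  have hTm := hT (-t) 1 one_pos le_rfl
  simp only [one_pow, div_one] at hTp hTm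
  have hm0 : ∀ ρ : ZetaZeros.riemannZetaNontrivialZeros, 0 ≤ (riemannZetaZeroOrder (ρ : ℂ) : ℝ) :=
    fun ρ ↦ ZetaZeroSum.zeroOrder_nonneg ρ
  have hgp0 : ∀ ρ, 0 ≤ gp ρ := fun ρ ↦ by have := hm0 ρ; positivity
  have hgm0 : ∀ ρ, 0 ≤ gm ρ := fun ρ ↦ by have := hm0 ρ; positivity
  -- each zero of the shell has weight ≥ 1
  have hone : ∀ ρ ∈ B \ A, (1 : ℝ) ≤ 5 / 4 * (gp ρ + gm ρ) := by
    intro ρ hρ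
    rw [Finset.mem_sdiff, hB, hA, Set.Finite.mem_toFinset, Set.Finite.mem_toFinset] at hρ
    obtain ⟨h1, h2⟩ := hρ
    simp only [Set.mem_setOf_eq, not_le] at h1 h2
    push_cast at h1
    have hm1 : (1 : ℝ) ≤ (riemannZetaZeroOrder (ρ : ℂ) : ℝ) := by
      exact_mod_cast ZetaZeros.riemannZetaNontrivialZeros.one_le_order ρ.2
    -- either `γ ∈ (N, N+1]` or `γ ∈ [-N-1, -N)`
    rcases le_or_gt 0 ((ρ : ℂ).im) with hpos | hneg
    · rw [abs_of_nonneg hpos] at h1 h2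
      have hsq : ((ρ : ℂ).im - t) ^ 2 ≤ 1 / 4 := by
        have ha : (ρ : ℂ).im - t - 1 / 2 ≤ 0 := by rw [ht]; linarith
        have hb : 0 ≤ (ρ : ℂ).im - t + 1 / 2 := by rw [ht]; linarith
        nlinarith [mul_nonneg hb (neg_nonneg.2 ha)]
      have hw : 4 / 5 ≤ 1 / (1 + ((ρ : ℂ).im - t) ^ 2) := by
        rw [div_le_div_iff₀ (by norm_num) (by positivity)]; nlinarith
      have hw0 : (0 : ℝ) ≤ 1 / (1 + ((ρ : ℂ).im - t) ^ 2) := by positivity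
      have : (1 : ℝ) ≤ 5 / 4 * gp ρ := by
        simp only [hgp]
        have h45 : (4 : ℝ) / 5 ≤ (riemannZetaZeroOrder (ρ : ℂ) : ℝ) / (1 + ((ρ : ℂ).im - t) ^ 2) :=
          calc (4 : ℝ) / 5 ≤ 1 * (1 / (1 + ((ρ : ℂ).im - t) ^ 2)) := by linarith
            _ ≤ (riemannZetaZeroOrder (ρ : ℂ) : ℝ) * (1 / (1 + ((ρ : ℂ).im - t) ^ 2)) :=
                mul_le_mul_of_nonneg_right hm1 hw0
            _ = _ := (div_eq_mul_one_div _ _).symm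
        linarith
      linarith [hgm0 ρ]
    · rw [abs_of_neg hneg] at h1 h2
      have hsq : ((ρ : ℂ).im - (-t)) ^ 2 ≤ 1 / 4 := by
        have ha : (ρ : ℂ).im - (-t) - 1 / 2 ≤ 0 := by rw [ht]; linarith
        have hb : 0 ≤ (ρ : ℂ).im - (-t) + 1 / 2 := by rw [ht]; linarith
        nlinarith [mul_nonneg hb (neg_nonneg.2 ha)]
      have hw : 4 / 5 ≤ 1 / (1 + ((ρ : ℂ).im - (-t)) ^ 2) := by
        rw [div_le_div_iff₀ (by norm_num) (by positivity)]; nlinarith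
      have hw0 : (0 : ℝ) ≤ 1 / (1 + ((ρ : ℂ).im - (-t)) ^ 2) := by positivity
      have : (1 : ℝ) ≤ 5 / 4 * gm ρ := by
        simp only [hgm]
        have h45 : (4 : ℝ) / 5 ≤ (riemannZetaZeroOrder (ρ : ℂ) : ℝ) / (1 + ((ρ : ℂ).im - (-t)) ^ 2) :=
          calc (4 : ℝ) / 5 ≤ 1 * (1 / (1 + ((ρ : ℂ).im - (-t)) ^ 2)) := by linarith
            _ ≤ (riemannZetaZeroOrder (ρ : ℂ) : ℝ) * (1 / (1 + ((ρ : ℂ).im - (-t)) ^ 2)) :=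
                mul_le_mul_of_nonneg_right hm1 hw0
            _ = _ := (div_eq_mul_one_div _ _).symm
        linarith
      linarith [hgp0 ρ]
  have hlog : Real.log (|t| + 4) ≤ Real.log ((N : ℝ) + 5) := by
    refine Real.log_le_log (by positivity) ?_
    rw [ht, abs_of_nonneg (by positivity)]; linarith
  have hlog' : Real.log (|-t| + 4) ≤ Real.log ((N : ℝ) + 5) := by rwa [abs_neg]
  calc (((B \ A).card : ℕ) : ℝ) = ∑ ρ ∈ B \ A, (1 : ℝ) := by simp
    _ ≤ ∑ ρ ∈ B \ A, 5 / 4 * (gp ρ + gm ρ) := Finset.sum_le_sum hone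
    _ = 5 / 4 * (∑ ρ ∈ B \ A, gp ρ + ∑ ρ ∈ B \ A, gm ρ) := by
        rw [← Finset.mul_sum, Finset.sum_add_distrib]
    _ ≤ 5 / 4 * (∑' ρ, gp ρ + ∑' ρ, gm ρ) := by
        gcongr
        · exact hTp.1.sum_le_tsum _ fun ρ _ ↦ hgp0 ρ
        · exact hTm.1.sum_le_tsum _ fun ρ _ ↦ hgm0 ρ
    _ ≤ 5 / 4 * (C_T * Real.log ((N : ℝ) + 5) + C_T * Real.log ((N : ℝ) + 5)) := by
        gcongr
        · exact hTp.2.trans (mul_le_mul_of_nonneg_left hlog hC_T0.le)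
        · exact hTm.2.trans (mul_le_mul_of_nonneg_left hlog' hC_T0.le)
    _ = 5 / 2 * C_T * Real.log ((N : ℝ) + 5) := by ring

/-- **The zero count is unbounded** (there are infinitely many non-trivial zeros — Hardy's theorem,
in the tree as `hardy_infinite_zeros_on_critical_line_holds`). [cite: Hardy1914, C. R. Acad. Sci. Paris 158] -/
private theorem exists_card_ge (M : ℕ) : ∃ N : ℕ, M ≤ (finite_abs_im_le (N : ℝ)).toFinset.card := by
  classical
  obtain ⟨F, hFsub, hFcard⟩ :=
    hardy_infinite_zeros_on_critical_line_holds.exists_subset_card_eq M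
  -- a height bound for the finitely many chosen ordinates
  obtain ⟨N, hN⟩ := exists_nat_ge (∑ t ∈ F, |t|)
  refine ⟨N, ?_⟩
  -- the injection `t ↦ ½ + it` from `F` into the counting set
  have hmem : ∀ t ∈ F, (1 / 2 + t * I : ℂ) ∈ ZetaZeros.riemannZetaNontrivialZeros := by
    intro t ht
    have hz : riemannZeta (1 / 2 + t * I) = 0 := hFsub ht
    exact (ZetaZeros.riemannZetaNontrivialZeros.mem_iff').2 ⟨hz, by simp, by norm_num⟩
  set G : Finset ℂ := F.image fun t : ℝ ↦ (1 / 2 + t * I : ℂ) with hG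
  have hGcard : G.card = M := by
    rw [hG, Finset.card_image_of_injective _ fun t₁ t₂ h ↦ ?_, hFcard]
    have := congrArg Complex.im h
    simpa using this
  set H : Finset ℂ := (finite_abs_im_le (N : ℝ)).toFinset.map (Function.Embedding.subtype _) with hH
  have hHcard : H.card = (finite_abs_im_le (N : ℝ)).toFinset.card := Finset.card_map _
  have hGH : G ⊆ H := by
    intro z hz
    rw [hG, Finset.mem_image] at hz
    obtain ⟨t, ht, rfl⟩ := hz
    rw [hH, Finset.mem_map]
    refine ⟨⟨_, hmem t ht⟩, ?_, rfl⟩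
    rw [Set.Finite.mem_toFinset, Set.mem_setOf_eq]
    have h1 : |t| ≤ ∑ s ∈ F, |s| := Finset.single_le_sum (fun s _ ↦ abs_nonneg s) ht
    have h2 : ((1 / 2 + t * I : ℂ)).im = t := by simp
    simp only [h2]
    exact h1.trans hN
  rw [← hHcard, ← hGcard]
  exact Finset.card_le_card hGH

end Zeros


section RankOne

variable {E : Type*} [NormedAddCommGroup E] [InnerProductSpace ℂ E]

open ConnesConsani2021

variable [CompleteSpace E]

/-- **Approximation numbers of a sum of rank-one operators with almost-orthogonal tails.**
Let `T = Σ_i λ_i ⟪q_i − o, ·⟫ (p_i − o)` (absolutely convergent in operator norm), `head ⊆ ι`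
finite. Off `head`, the operators `λ_i ⟪q_i, ·⟫ p_i` sum to an operator `R` of norm `≤ K` as soon
as the families `p`, `q` satisfy the Schur row-sum condition with weights `|λ_j|` and constant `K`
on every finite subset of the tail; and `T − R` has range inside the span of
`{o, w} ∪ {p_i − o : i ∈ head}` (`w = Σ_{tail} λ_i p_i`), hence rank `≤ #head + 2`. So
`a_{#head+2}(T) ≤ ‖R‖ ≤ K`. [folklore] -/
private theorem approxNumber_tsum_rankOne_le {ι : Type*} (p q : ι → E) (o : E) (lam : ι → ℂ)
    (head : Set ι) [DecidablePred (· ∈ head)] (hfin : head.Finite)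
    {B : ℝ} (hBp : ∀ i, ‖p i‖ ≤ B) (hBq : ∀ i, ‖q i‖ ≤ B) (hBo : ‖o‖ ≤ B)
    (hlam : Summable fun i ↦ ‖lam i‖) {K : ℝ} (hK0 : 0 ≤ K)
    (hp : ∀ s : Finset ι, (∀ i ∈ s, i ∉ head) →
      ∀ i ∈ s, ∑ j ∈ s, ‖lam j‖ * ‖⟪p i, p j⟫_ℂ‖ ≤ K)
    (hq : ∀ s : Finset ι, (∀ i ∈ s, i ∉ head) →
      ∀ i ∈ s, ∑ j ∈ s, ‖lam j‖ * ‖⟪q i, q j⟫_ℂ‖ ≤ K) :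
    Summable (fun i ↦ lam i • (innerSL ℂ (q i - o)).smulRight (p i - o)) ∧
      approxNumber (∑' i, lam i • (innerSL ℂ (q i - o)).smulRight (p i - o))
        (hfin.toFinset.card + 2) ≤ K := by
  classical
  have hB0 : 0 ≤ B := (norm_nonneg o).trans hBo
  set F : ι → E →L[ℂ] E := fun i ↦ lam i • (innerSL ℂ (q i - o)).smulRight (p i - o) with hF_def
  set M : ι → E →L[ℂ] E := fun i ↦
    if i ∈ head then 0 else lam i • (innerSL ℂ (q i)).smulRight (p i) with hM_def
  -- norm bounds and summability
  have hpo : ∀ i, ‖p i - o‖ ≤ 2 * B := fun i ↦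
    (norm_sub_le _ _).trans (by linarith [hBp i])
  have hqo : ∀ i, ‖q i - o‖ ≤ 2 * B := fun i ↦
    (norm_sub_le _ _).trans (by linarith [hBq i])
  have hF_norm : ∀ i, ‖F i‖ ≤ ‖lam i‖ * (2 * B * (2 * B)) := by
    intro i
    simp only [hF_def]
    rw [norm_smul, ContinuousLinearMap.norm_smulRight_apply, innerSL_apply_norm]
    gcongr
    · exact hqo i
    · exact hpo i
  have hF_summ : Summable F :=
    Summable.of_norm_bounded (hlam.mul_right _) hF_norm
  have hM_norm : ∀ i, ‖M i‖ ≤ ‖lam i‖ * (B * B) := by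
    intro i
    simp only [hM_def]
    split_ifs
    · rw [norm_zero]; positivity
    · rw [norm_smul, ContinuousLinearMap.norm_smulRight_apply, innerSL_apply_norm]
      gcongr
      · exact hBq i
      · exact hBp i
  have hM_summ : Summable M := Summable.of_norm_bounded (hlam.mul_right _) hM_norm
  set T : E →L[ℂ] E := ∑' i, F i with hT_def
  set R : E →L[ℂ] E := ∑' i, M i with hR_def
  -- Step 1: `‖R‖ ≤ K`
  have hR : ‖R‖ ≤ K := by
    refine norm_tsum_le_of_sum_le hM_summ fun s ↦ ?_
    have hs : ∑ i ∈ s, M i =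
        ∑ i ∈ s.filter (fun i ↦ i ∉ head), lam i • (innerSL ℂ (q i)).smulRight (p i) := by
      rw [Finset.sum_filter]
      refine Finset.sum_congr rfl fun i _ ↦ ?_
      simp only [hM_def, ite_not]
    rw [hs]
    have hmem : ∀ i ∈ s.filter (fun i ↦ i ∉ head), i ∉ head := fun i hi ↦ (Finset.mem_filter.1 hi).2
    exact norm_sum_rankOne_le _ p q lam hK0 (hp _ hmem) (hq _ hmem)
  -- Step 2: the range of `T − R`
  set w : E := ∑' i, (if i ∈ head then (0 : E) else lam i • p i) with hw_def
  have hw_summ : Summable fun i ↦ (if i ∈ head then (0 : E) else lam i • p i) := by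
    refine Summable.of_norm_bounded (hlam.mul_right B) fun i ↦ ?_
    split_ifs
    · rw [norm_zero]; positivity
    · rw [norm_smul]; gcongr; exact hBp i
  set S : Finset E := insert o (insert w (hfin.toFinset.image fun i ↦ p i - o)) with hS_def
  have hrange : ∀ φ, (T - R) φ ∈ Submodule.span ℂ (S : Set E) := by
    intro φ
    -- the three sums
    have hTφ : HasSum (fun i ↦ F i φ) (T φ) := by
      have := hF_summ.hasSum.mapL (ContinuousLinearMap.apply ℂ E φ)
      simpa only [ContinuousLinearMap.apply_apply] using this
    have hRφ : HasSum (fun i ↦ M i φ) (R φ) := by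
      have := hM_summ.hasSum.mapL (ContinuousLinearMap.apply ℂ E φ)
      simpa only [ContinuousLinearMap.apply_apply] using this
    have hDφ : HasSum (fun i ↦ F i φ - M i φ) ((T - R) φ) := by
      rw [sub_apply]; exact hTφ.sub hRφ
    -- scalar tail sum
    have hc_summ : Summable fun i ↦
        (if i ∈ head then (0 : ℂ) else lam i * (⟪o, φ⟫_ℂ - ⟪q i, φ⟫_ℂ)) := by
      refine Summable.of_norm_bounded (hlam.mul_right (2 * B * ‖φ‖)) fun i ↦ ?_
      split_ifs
      · rw [norm_zero]; positivity
      · rw [norm_mul]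
        gcongr
        calc ‖⟪o, φ⟫_ℂ - ⟪q i, φ⟫_ℂ‖ ≤ ‖⟪o, φ⟫_ℂ‖ + ‖⟪q i, φ⟫_ℂ‖ := norm_sub_le _ _
          _ ≤ ‖o‖ * ‖φ‖ + ‖q i‖ * ‖φ‖ := add_le_add (norm_inner_le_norm _ _) (norm_inner_le_norm _ _)
          _ ≤ B * ‖φ‖ + B * ‖φ‖ := by
              gcongr
              exact hBq i
          _ = 2 * B * ‖φ‖ := by ring
    set c : ℂ := ∑' i, (if i ∈ head then (0 : ℂ) else lam i * (⟪o, φ⟫_ℂ - ⟪q i, φ⟫_ℂ)) with hc_def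
    -- decomposition of the general term
    have hdecomp : ∀ i, F i φ - M i φ =
        (if i ∈ head then F i φ else 0) +
          ((-⟪o, φ⟫_ℂ) • (if i ∈ head then (0 : E) else lam i • p i) +
            (if i ∈ head then (0 : ℂ) else lam i * (⟪o, φ⟫_ℂ - ⟪q i, φ⟫_ℂ)) • o) := by
      intro i
      by_cases hi : i ∈ head
      · simp only [hM_def, if_pos hi, zero_apply, sub_zero, smul_zero,
          zero_smul, add_zero]
      · simp only [hF_def, hM_def, if_neg hi, smul_apply, ContinuousLinearMap.smulRight_apply,
          innerSL_apply_apply, inner_sub_left, zero_add]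
        module
    have hhead : HasSum (fun i ↦ if i ∈ head then F i φ else 0)
        (∑ i ∈ hfin.toFinset, F i φ) := by
      have h : HasSum (fun i ↦ if i ∈ head then F i φ else 0)
          (∑ i ∈ hfin.toFinset, (if i ∈ head then F i φ else 0)) :=
        hasSum_sum_of_ne_finset_zero (fun i hi ↦ by
          rw [Set.Finite.mem_toFinset] at hi; exact if_neg hi)
      have hs : ∑ i ∈ hfin.toFinset, (if i ∈ head then F i φ else 0) =
          ∑ i ∈ hfin.toFinset, F i φ :=
        Finset.sum_congr rfl fun i hi ↦ by
          rw [Set.Finite.mem_toFinset] at hi; exact if_pos hi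
      rwa [hs] at h
    have htail : HasSum (fun i ↦ (-⟪o, φ⟫_ℂ) • (if i ∈ head then (0 : E) else lam i • p i) +
        (if i ∈ head then (0 : ℂ) else lam i * (⟪o, φ⟫_ℂ - ⟪q i, φ⟫_ℂ)) • o)
        ((-⟪o, φ⟫_ℂ) • w + c • o) :=
      (hw_summ.hasSum.const_smul _).add (hc_summ.hasSum.smul_const o)
    have hsum := hhead.add htail
    have heq : (T - R) φ = ∑ i ∈ hfin.toFinset, F i φ + ((-⟪o, φ⟫_ℂ) • w + c • o) := by
      refine hDφ.unique ?_
      refine hsum.congr_fun fun i ↦ ?_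
      exact hdecomp i
    rw [heq]
    have hS_o : o ∈ Submodule.span ℂ (S : Set E) :=
      Submodule.subset_span (by simp [hS_def])
    have hS_w : w ∈ Submodule.span ℂ (S : Set E) :=
      Submodule.subset_span (by simp [hS_def])
    have hS_p : ∀ i ∈ hfin.toFinset, p i - o ∈ Submodule.span ℂ (S : Set E) := fun i hi ↦
      Submodule.subset_span (by
        simp only [hS_def, Finset.coe_insert, Finset.coe_image, Set.mem_insert_iff, Set.mem_image,
          Finset.mem_coe]
        exact Or.inr (Or.inr ⟨i, hi, rfl⟩))
    refine Submodule.add_mem _ (Submodule.sum_mem _ fun i hi ↦ ?_)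
      (Submodule.add_mem _ (Submodule.smul_mem _ _ hS_w) (Submodule.smul_mem _ _ hS_o))
    simp only [hF_def, smul_apply, ContinuousLinearMap.smulRight_apply, innerSL_apply_apply]
    exact Submodule.smul_mem _ _ (Submodule.smul_mem _ _ (hS_p i hi))
  -- Step 3: rank bound and conclusion
  have hcardS : S.card ≤ hfin.toFinset.card + 2 := by
    calc S.card ≤ (insert w (hfin.toFinset.image fun i ↦ p i - o)).card + 1 :=
          Finset.card_insert_le _ _
      _ ≤ ((hfin.toFinset.image fun i ↦ p i - o).card + 1) + 1 := by
          gcongr; exact Finset.card_insert_le _ _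
      _ ≤ (hfin.toFinset.card + 1) + 1 := by
          gcongr; exact Finset.card_image_le
      _ = hfin.toFinset.card + 2 := by ring
  have hrank : Module.rank ℂ (LinearMap.range ((T - R : E →L[ℂ] E) : E →ₗ[ℂ] E)) ≤
      (hfin.toFinset.card + 2 : ℕ) :=
    (rank_range_le_card S hrange).trans (by exact_mod_cast hcardS)
  refine ⟨hF_summ, ?_⟩
  have h := approxNumber_le_of_rank_le T (T - R) hrank
  rw [sub_sub_cancel] at h
  exact h.trans hR

end RankOne



/-! ## H. The operator `𝖦_g[a]` as a sum of rank-one operators over the zeros -/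

section Final

open ConnesConsani2021

variable {a : ℝ}

/-- For a non-trivial zero `ρ`, `|Re(ρ − ½)| ≤ ½`. [folklore] -/
private theorem abs_re_kappa_le (ρ : ZetaZeros.riemannZetaNontrivialZeros) :
    |((ρ : ℂ) - 1 / 2).re| ≤ 1 / 2 := by
  have h0 := ZetaZeros.riemannZetaNontrivialZeros.re_pos ρ.2
  have h1 := ZetaZeros.riemannZetaNontrivialZeros.re_lt_one ρ.2
  have : ((ρ : ℂ) - 1 / 2).re = (ρ : ℂ).re - 1 / 2 := by simp
  rw [this, abs_le]; constructor <;> linarith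

/-- `Im(ρ − ½) = Im ρ`. [folklore] -/
private theorem im_kappa (ρ : ZetaZeros.riemannZetaNontrivialZeros) :
    ((ρ : ℂ) - 1 / 2).im = (ρ : ℂ).im := by simp

/-- `‖−m(ρ)/(ρ − ½)²‖ = m(ρ)/|ρ − ½|²`. [folklore] -/
private theorem norm_coeff (ρ : ZetaZeros.riemannZetaNontrivialZeros) :
    ‖-((riemannZetaZeroOrder (ρ : ℂ) : ℂ)) / ((ρ : ℂ) - 1 / 2) ^ 2‖ =
      (riemannZetaZeroOrder (ρ : ℂ) : ℝ) / ‖(ρ : ℂ) - 1 / 2‖ ^ 2 := by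
  rw [norm_div, norm_neg, norm_pow, Complex.norm_intCast,
    abs_of_nonneg (ZetaZeroSum.zeroOrder_nonneg ρ)]

/-- **Level-`N` approximation bound.** For a family `e z ∈ L²(−a,a)` of exponentials, the operator
`T = Σ_ρ (−m(ρ)/(ρ−½)²) ⟪e(ρ̄−½) − e 0, ·⟫ (e(½−ρ) − e 0)` converges absolutely in operator norm
and `a_{n(N)+2}(T) ≤ C/(N√N)` for every `N ≥ 1`, where `n(N) = #{ρ : |Im ρ| ≤ N}` (Schur bounds
from `key_estimate` and the Gram bound `norm_inner_expVec_le`, fed to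
`approxNumber_tsum_rankOne_le`). [folklore] -/
private theorem approxNumber_screwOp_le (ha : 0 < a)
    (e : ℂ → Lp ℂ 2 (volume.restrict (Ioo (-a) a)))
    (he : ∀ z, (e z : ℝ → ℂ) =ᵐ[volume.restrict (Ioo (-a) a)] fun u ↦ cexp (z * u)) :
    ∃ C : ℝ, 0 ≤ C ∧
      Summable (fun ρ : ZetaZeros.riemannZetaNontrivialZeros ↦
        (-((riemannZetaZeroOrder (ρ : ℂ) : ℂ)) / ((ρ : ℂ) - 1 / 2) ^ 2) •
          (innerSL ℂ (e (conj ((ρ : ℂ) - 1 / 2)) - e 0)).smulRight (e (-((ρ : ℂ) - 1 / 2)) - e 0)) ∧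
      ∀ N : ℕ, 1 ≤ N →
        approxNumber (∑' ρ : ZetaZeros.riemannZetaNontrivialZeros,
          (-((riemannZetaZeroOrder (ρ : ℂ) : ℂ)) / ((ρ : ℂ) - 1 / 2) ^ 2) •
            (innerSL ℂ (e (conj ((ρ : ℂ) - 1 / 2)) - e 0)).smulRight (e (-((ρ : ℂ) - 1 / 2)) - e 0))
          ((finite_abs_im_le (N : ℝ)).toFinset.card + 2) ≤ C / ((N : ℝ) * Real.sqrt N) := by
  classical
  obtain ⟨C_K, hC_K0, hkey⟩ := key_estimate
  set M₁ : ℝ := 4 * Real.exp a * max a 1 with hM₁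
  have hM₁0 : 0 ≤ M₁ := by positivity
  set B : ℝ := Real.sqrt (2 * a * Real.exp a) with hB
  -- norm bounds for the three families of vectors
  have hnorm : ∀ z : ℂ, |z.re| ≤ 1 / 2 → ‖e z‖ ≤ B := fun z hz ↦
    (Real.le_sqrt (norm_nonneg _) (by positivity)).2 (norm_expVec_sq_le e ha he hz)
  have hre_p : ∀ ρ : ZetaZeros.riemannZetaNontrivialZeros, |(-((ρ : ℂ) - 1 / 2)).re| ≤ 1 / 2 :=
    fun ρ ↦ by rw [neg_re, abs_neg]; exact abs_re_kappa_le ρ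
  have hre_q : ∀ ρ : ZetaZeros.riemannZetaNontrivialZeros, |(conj ((ρ : ℂ) - 1 / 2)).re| ≤ 1 / 2 :=
    fun ρ ↦ by rw [conj_re]; exact abs_re_kappa_le ρ
  have hBp : ∀ ρ : ZetaZeros.riemannZetaNontrivialZeros, ‖e (-((ρ : ℂ) - 1 / 2))‖ ≤ B := fun ρ ↦
    hnorm _ (hre_p ρ)
  have hBq : ∀ ρ : ZetaZeros.riemannZetaNontrivialZeros, ‖e (conj ((ρ : ℂ) - 1 / 2))‖ ≤ B :=
    fun ρ ↦ hnorm _ (hre_q ρ)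
  have hBo : ‖e 0‖ ≤ B := hnorm 0 (by simp)
  have hlam : Summable fun ρ : ZetaZeros.riemannZetaNontrivialZeros ↦
      ‖-((riemannZetaZeroOrder (ρ : ℂ) : ℂ)) / ((ρ : ℂ) - 1 / 2) ^ 2‖ := by
    refine ZetaScrewProp31.summable_zeroOrder_div_norm_sub_half_sq.congr fun ρ ↦ ?_
    rw [norm_coeff]
  -- the Schur row sums on the tail `|γ| > N`
  have hschur : ∀ N : ℕ, 1 ≤ N → ∀ (z : ZetaZeros.riemannZetaNontrivialZeros → ℂ),
      (∀ ρ, |(z ρ).re| ≤ 1 / 2) → (∀ ρ, (z ρ).im = -(ρ : ℂ).im) →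
      ∀ s : Finset ZetaZeros.riemannZetaNontrivialZeros,
        (∀ i ∈ s, i ∉ {ρ : ZetaZeros.riemannZetaNontrivialZeros | |(ρ : ℂ).im| ≤ (N : ℝ)}) →
        ∀ i ∈ s, ∑ j ∈ s, ‖-((riemannZetaZeroOrder (j : ℂ) : ℂ)) / ((j : ℂ) - 1 / 2) ^ 2‖ *
          ‖⟪e (z i), e (z j)⟫_ℂ‖ ≤ M₁ * (C_K / ((N : ℝ) * Real.sqrt N)) := by
    intro N hN z hzre hzim s hs i hi
    have htail : ∀ j ∈ s, (N : ℝ) < |(j : ℂ).im| := fun j hj ↦ not_le.1 (hs j hj)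
    obtain ⟨hsum, hbound⟩ := hkey N hN ((i : ℂ).im) (htail i hi)
    set f : ZetaZeros.riemannZetaNontrivialZeros → ℝ := fun ρ ↦
      if (N : ℝ) < |(ρ : ℂ).im| then
        (riemannZetaZeroOrder (ρ : ℂ) : ℝ) / ‖(ρ : ℂ) - 1 / 2‖ ^ 2 *
          (1 / (1 + |(i : ℂ).im - (ρ : ℂ).im|))
      else 0 with hf
    have hf0 : ∀ ρ, 0 ≤ f ρ := fun ρ ↦ by
      simp only [hf]
      split_ifs
      · have := ZetaZeroSum.zeroOrder_nonneg ρ; positivity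
      · exact le_rfl
    calc ∑ j ∈ s, ‖-((riemannZetaZeroOrder (j : ℂ) : ℂ)) / ((j : ℂ) - 1 / 2) ^ 2‖ * ‖⟪e (z i), e (z j)⟫_ℂ‖
        ≤ ∑ j ∈ s, M₁ * f j := by
          refine Finset.sum_le_sum fun j hj ↦ ?_
          rw [norm_coeff]
          have hG := norm_inner_expVec_le e ha he (hzre i) (hzre j)
          rw [hzim i, hzim j, show -(j : ℂ).im - -(i : ℂ).im = (i : ℂ).im - (j : ℂ).im by ring] at hG
          simp only [hf, if_pos (htail j hj)]
          have hm := ZetaZeroSum.zeroOrder_nonneg j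
          calc (riemannZetaZeroOrder (j : ℂ) : ℝ) / ‖(j : ℂ) - 1 / 2‖ ^ 2 * ‖⟪e (z i), e (z j)⟫_ℂ‖
              ≤ (riemannZetaZeroOrder (j : ℂ) : ℝ) / ‖(j : ℂ) - 1 / 2‖ ^ 2 *
                  (4 * Real.exp a * max a 1 / (1 + |(i : ℂ).im - (j : ℂ).im|)) :=
                mul_le_mul_of_nonneg_left hG (by positivity)
            _ = M₁ * ((riemannZetaZeroOrder (j : ℂ) : ℝ) / ‖(j : ℂ) - 1 / 2‖ ^ 2 *
                  (1 / (1 + |(i : ℂ).im - (j : ℂ).im|))) := by rw [hM₁]; ring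
      _ = M₁ * ∑ j ∈ s, f j := by rw [Finset.mul_sum]
      _ ≤ M₁ * ∑' j, f j := by
          gcongr
          exact hsum.sum_le_tsum s fun j _ ↦ hf0 j
      _ ≤ M₁ * (C_K / ((N : ℝ) * Real.sqrt N)) := by gcongr
  -- apply the generic rank-one lemma at each level `N`
  have hlevel : ∀ N : ℕ, 1 ≤ N →
      Summable (fun ρ : ZetaZeros.riemannZetaNontrivialZeros ↦
        (-((riemannZetaZeroOrder (ρ : ℂ) : ℂ)) / ((ρ : ℂ) - 1 / 2) ^ 2) •
          (innerSL ℂ (e (conj ((ρ : ℂ) - 1 / 2)) - e 0)).smulRight (e (-((ρ : ℂ) - 1 / 2)) - e 0)) ∧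
      approxNumber (∑' ρ : ZetaZeros.riemannZetaNontrivialZeros,
          (-((riemannZetaZeroOrder (ρ : ℂ) : ℂ)) / ((ρ : ℂ) - 1 / 2) ^ 2) •
            (innerSL ℂ (e (conj ((ρ : ℂ) - 1 / 2)) - e 0)).smulRight (e (-((ρ : ℂ) - 1 / 2)) - e 0))
          ((finite_abs_im_le (N : ℝ)).toFinset.card + 2) ≤ M₁ * (C_K / ((N : ℝ) * Real.sqrt N)) := by
    intro N hN
    exact approxNumber_tsum_rankOne_le (E := Lp ℂ 2 (volume.restrict (Ioo (-a) a)))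
      (fun ρ : ZetaZeros.riemannZetaNontrivialZeros ↦ e (-((ρ : ℂ) - 1 / 2)))
      (fun ρ ↦ e (conj ((ρ : ℂ) - 1 / 2))) (e 0)
      (fun ρ ↦ -((riemannZetaZeroOrder (ρ : ℂ) : ℂ)) / ((ρ : ℂ) - 1 / 2) ^ 2)
      {ρ | |(ρ : ℂ).im| ≤ (N : ℝ)} (finite_abs_im_le (N : ℝ)) hBp hBq hBo hlam
      (by positivity)
      (hschur N hN (fun ρ ↦ -((ρ : ℂ) - 1 / 2)) hre_p (fun ρ ↦ by rw [neg_im, im_kappa]))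
      (hschur N hN (fun ρ ↦ conj ((ρ : ℂ) - 1 / 2)) hre_q (fun ρ ↦ by rw [conj_im, im_kappa]))
  refine ⟨M₁ * C_K, by positivity, (hlevel 1 le_rfl).1, fun N hN ↦ ?_⟩
  have h := (hlevel N hN).2
  rwa [← mul_div_assoc] at h

/-- `⟪φ, e z⟫ = ∫ e^{zu} conj φ(u) du`. [folklore] -/
private theorem inner_expVec_right (e : ℂ → Lp ℂ 2 (volume.restrict (Ioo (-a) a)))
    (he : ∀ z, (e z : ℝ → ℂ) =ᵐ[volume.restrict (Ioo (-a) a)] fun u ↦ cexp (z * u))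
    (z : ℂ) (φ : Lp ℂ 2 (volume.restrict (Ioo (-a) a))) :
    ⟪φ, e z⟫_ℂ = ∫ u, cexp (z * u) * conj ((φ : ℝ → ℂ) u) ∂(volume.restrict (Ioo (-a) a)) := by
  rw [MeasureTheory.L2.inner_def]
  refine integral_congr_ae ((he z).mono fun u hu ↦ ?_)
  dsimp only
  rw [hu, RCLike.inner_apply]

/-- `e^{zu} φ(u)` is integrable on the window for `φ ∈ L²(−a,a)`. [folklore] -/
private theorem integrable_cexp_mul {φ : ℝ → ℂ} (hφ : Integrable φ (volume.restrict (Ioo (-a) a)))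
    (z : ℂ) : Integrable (fun u : ℝ ↦ cexp (z * u) * φ u) (volume.restrict (Ioo (-a) a)) := by
  have hcont : Continuous fun u : ℝ ↦ cexp (z * u) := by fun_prop
  have hbd : ∀ᵐ u : ℝ ∂(volume.restrict (Ioo (-a) a)), ‖cexp (z * (u : ℂ))‖ ≤ Real.exp (|z.re| * |a|) := by
    refine (ae_restrict_mem measurableSet_Ioo).mono fun u hu ↦ ?_
    rw [Complex.norm_exp, Real.exp_le_exp, Complex.re_mul_ofReal]
    calc z.re * u ≤ |z.re * u| := le_abs_self _
      _ = |z.re| * |u| := abs_mul _ _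
      _ ≤ |z.re| * |a| := by
          refine mul_le_mul_of_nonneg_left ?_ (abs_nonneg _)
          rw [abs_le]
          constructor <;> nlinarith [hu.1, hu.2, le_abs_self a, neg_abs_le a]
  exact hφ.bdd_mul hcont.aestronglyMeasurable hbd

/-- **The sum of rank-one operators realises `𝖦_g[a]`.** If `T = Σ_ρ (−m(ρ)/(ρ−½)²)
⟪e(ρ̄−½) − e 0, ·⟫ (e(½−ρ) − e 0)` in operator norm, then `(Tφ)(t) = ∫_{(−a,a)} G_g(t,u)φ(u)du`
for a.e. `t ∈ (−a,a)`: pairing with `ψ ∈ L²(−a,a)` gives the series (3.1) (`Suzuki2023_eq301`,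
integrable data) termwise, whose sum is `⟨φ,ψ⟩_{G_g,a} = ⟪ψ, 𝖦_g[a]φ⟫`. [cite: Suzuki2023, eq. (3.1) p. 7 and §5 p. 15] -/
private theorem tsum_rankOne_apply_ae_eq_zetaScrewOp (ha : 0 < a)
    (e : ℂ → Lp ℂ 2 (volume.restrict (Ioo (-a) a)))
    (he : ∀ z, (e z : ℝ → ℂ) =ᵐ[volume.restrict (Ioo (-a) a)] fun u ↦ cexp (z * u))
    {T : Lp ℂ 2 (volume.restrict (Ioo (-a) a)) →L[ℂ] Lp ℂ 2 (volume.restrict (Ioo (-a) a))}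
    (hT : HasSum (fun ρ : ZetaZeros.riemannZetaNontrivialZeros ↦
        (-((riemannZetaZeroOrder (ρ : ℂ) : ℂ)) / ((ρ : ℂ) - 1 / 2) ^ 2) •
          (innerSL ℂ (e (conj ((ρ : ℂ) - 1 / 2)) - e 0)).smulRight (e (-((ρ : ℂ) - 1 / 2)) - e 0)) T)
    (φ : Lp ℂ 2 (volume.restrict (Ioo (-a) a))) :
    (T φ : ℝ → ℂ) =ᵐ[volume.restrict (Ioo (-a) a)] zetaScrewOp (Ioo (-a) a) φ := by
  have _ := ha
  have hφi : Integrable (φ : ℝ → ℂ) (volume.restrict (Ioo (-a) a)) :=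
    (Lp.memLp φ).integrable one_le_two
  suffices hTφ : T φ = (memLp_zetaScrewOp φ).toLp _ by
    rw [hTφ]; exact MemLp.coeFn_toLp _
  refine ext_inner_left ℂ fun ψ ↦ ?_
  have hψi : Integrable (ψ : ℝ → ℂ) (volume.restrict (Ioo (-a) a)) :=
    (Lp.memLp ψ).integrable one_le_two
  have hψc : Integrable (fun t ↦ conj ((ψ : ℝ → ℂ) t)) (volume.restrict (Ioo (-a) a)) :=
    Complex.conjLIE.toContinuousLinearEquiv.toContinuousLinearMap.integrable_comp hψi
  rw [← zetaScrewForm_eq_inner]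
  -- the series for `⟪ψ, Tφ⟫`
  have h1 : HasSum (fun ρ : ZetaZeros.riemannZetaNontrivialZeros ↦
      ⟪ψ, ((-((riemannZetaZeroOrder (ρ : ℂ) : ℂ)) / ((ρ : ℂ) - 1 / 2) ^ 2) •
          (innerSL ℂ (e (conj ((ρ : ℂ) - 1 / 2)) - e 0)).smulRight (e (-((ρ : ℂ) - 1 / 2)) - e 0)) φ⟫_ℂ)
      ⟪ψ, T φ⟫_ℂ := by
    have := (hT.mapL (ContinuousLinearMap.apply ℂ _ φ)).mapL (innerSL ℂ ψ)
    simpa only [ContinuousLinearMap.apply_apply, innerSL_apply_apply] using this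
  -- (3.1) for the integrable pair `(φ, ψ)`
  have h2 := Suzuki2023_eq301 (a := a) (φ₁ := (φ : ℝ → ℂ)) (φ₂ := (ψ : ℝ → ℂ)) hφi hψi
  refine h1.unique (h2.congr_fun fun ρ ↦ ?_)
  -- the `ρ`-th terms agree
  set κ : ℂ := (ρ : ℂ) - 1 / 2 with hκ
  have hy : ⟪e (conj κ) - e 0, φ⟫_ℂ =
      ∫ u in Ioo (-a) a, (cexp (κ * u) - 1) * (φ : ℝ → ℂ) u := by
    rw [inner_sub_left, inner_expVec_left e he, inner_expVec_left e he, Complex.conj_conj, map_zero,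
      ← integral_sub (integrable_cexp_mul hφi κ) (integrable_cexp_mul hφi 0)]
    refine integral_congr_ae (Eventually.of_forall fun u ↦ ?_)
    simp only [zero_mul, Complex.exp_zero]
    ring
  have hx : ⟪ψ, e (-κ) - e 0⟫_ℂ =
      ∫ t in Ioo (-a) a, (cexp (-κ * t) - 1) * conj ((ψ : ℝ → ℂ) t) := by
    rw [inner_sub_right, inner_expVec_right e he, inner_expVec_right e he,
      ← integral_sub (integrable_cexp_mul hψc (-κ)) (integrable_cexp_mul hψc 0)]
    refine integral_congr_ae (Eventually.of_forall fun u ↦ ?_)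
    simp only [zero_mul, Complex.exp_zero]
    ring
  rw [smul_apply, ContinuousLinearMap.smulRight_apply, innerSL_apply_apply, inner_smul_right,
    inner_smul_right, hy, hx]
  ring

end Final

end ZetaScrewTraceClassProof

open ConnesConsani2021 ZetaScrewTraceClassProof in
/-- **DISCHARGE of `Suzuki2023_thm15` (Suzuki JLMS 2023, Thm. 1.5): for every `0 < a`, the
integral operator `𝖦_g[a]` (1.12) on `L²(−a,a)` is realised by a bounded operator of trace class
(summable approximation numbers, `ConnesConsani2021.IsTraceClass`) — unconditionally.**
Proof (see the module docstring): `𝖦_g[a] = Σ_ρ (−m(ρ)/(ρ−½)²) ⟪e(ρ̄−½)−1, ·⟫ (e(½−ρ)−1)`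
by (1.9)/(3.1); truncating at height `N` and absorbing the constant directions leaves a tail of
operator norm `≤ C/(N√N)` by the large sieve at the zeta ordinates, while consecutive truncation
ranks differ by `≪ log N`; hence `Σ_n a_n(𝖦_g[a]) < ∞`. RH-FREE. [cite: Suzuki2023, Thm 1.5, p. 3 (held text p0003:L108–110); proof §6.1 p. 16] -/
theorem Suzuki2023_thm15_holds : Suzuki2023_thm15 := by
  intro a ha
  classical
  -- the exponentials `e z = [u ↦ e^{zu}] ∈ L²(−a,a)`
  set e : ℂ → Lp ℂ 2 (volume.restrict (Ioo (-a) a)) := fun z ↦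
    (memLp_two_cexp a z).toLp (fun u : ℝ ↦ cexp (z * u)) with he_def
  have he : ∀ z, (e z : ℝ → ℂ) =ᵐ[volume.restrict (Ioo (-a) a)] fun u ↦ cexp (z * u) :=
    fun z ↦ MemLp.coeFn_toLp _
  obtain ⟨C, hC0, hsumm, hlevel⟩ := approxNumber_screwOp_le ha e he
  set T : Lp ℂ 2 (volume.restrict (Ioo (-a) a)) →L[ℂ] Lp ℂ 2 (volume.restrict (Ioo (-a) a)) :=
    ∑' ρ : ZetaZeros.riemannZetaNontrivialZeros,
      (-((riemannZetaZeroOrder (ρ : ℂ) : ℂ)) / ((ρ : ℂ) - 1 / 2) ^ 2) •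
        (innerSL ℂ (e (conj ((ρ : ℂ) - 1 / 2)) - e 0)).smulRight (e (-((ρ : ℂ) - 1 / 2)) - e 0)
    with hT_def
  refine ⟨T, fun φ ↦ tsum_rankOne_apply_ae_eq_zetaScrewOp ha e he hsumm.hasSum φ, ?_⟩
  -- trace class: block summation of the approximation numbers
  obtain ⟨D, hD0, hD⟩ := exists_card_increment_le
  set h : ℕ → ℕ := fun N ↦ (finite_abs_im_le (N : ℝ)).toFinset.card + 2 with hh_def
  set c : ℕ → ℝ := fun N ↦ if N = 0 then ‖T‖ else C / ((N : ℝ) * Real.sqrt N) with hc_def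
  set d : ℕ → ℝ := fun N ↦ D * Real.log ((N : ℝ) + 5) with hd_def
  have hmono : Monotone h := by
    intro N N' hNN'
    simp only [hh_def]
    exact Nat.add_le_add_right (Finset.card_le_card (finite_abs_im_le_mono (by exact_mod_cast hNN'))) 2
  have htop : Tendsto h atTop atTop := by
    refine hmono.tendsto_atTop_atTop fun M ↦ ?_
    obtain ⟨N, hN⟩ := exists_card_ge M
    exact ⟨N, by simp only [hh_def]; omega⟩
  have hc0 : ∀ N, 0 ≤ c N := fun N ↦ by
    simp only [hc_def]
    split_ifs
    · exact norm_nonneg _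
    · positivity
  have hc : ∀ N, approxNumber T (h N) ≤ c N := by
    intro N
    simp only [hc_def, hh_def]
    split_ifs with hN
    · exact approxNumber_le_norm _ _
    · exact hlevel N (Nat.one_le_iff_ne_zero.2 hN)
  have hd : ∀ N, ((h (N + 1) : ℝ) - h N) ≤ d N := by
    intro N
    have := hD N
    simp only [hh_def, hd_def]
    push_cast at this ⊢
    linarith
  -- `Σ_N d N · c N < ∞`: compare with `N^{-5/4}`
  have hdc : Summable fun N ↦ d N * c N := by
    rw [← summable_nat_add_iff 1]
    have hmaj : ∀ N : ℕ, d (N + 1) * c (N + 1) ≤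
        8 * D * C * (((N + 1 : ℕ) : ℝ) ^ (5 / 4 : ℝ))⁻¹ := by
      intro N
      have hN1 : (1 : ℝ) ≤ ((N + 1 : ℕ) : ℝ) := by exact_mod_cast Nat.le_add_left 1 N
      set n : ℝ := ((N + 1 : ℕ) : ℝ) with hn
      have hnpos : 0 < n := by linarith
      set r : ℝ := Real.sqrt (Real.sqrt n) with hr
      have hrpos : 0 < r := Real.sqrt_pos.2 (Real.sqrt_pos.2 hnpos)
      have hr2 : r ^ 2 = Real.sqrt n := by rw [hr, Real.sq_sqrt (Real.sqrt_nonneg _)]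
      have hr4 : r ^ 4 = n := by
        rw [show r ^ 4 = (r ^ 2) ^ 2 by ring, hr2, Real.sq_sqrt hnpos.le]
      have hrpow : n ^ (5 / 4 : ℝ) = r ^ 5 := by
        have h45 : ((4 : ℕ) : ℝ) * (5 / 4 : ℝ) = ((5 : ℕ) : ℝ) := by norm_num
        rw [← hr4, ← Real.rpow_natCast r 4, ← Real.rpow_mul hrpos.le, h45, Real.rpow_natCast]
      -- `log(n+5) ≤ 4 √√(n+5) ≤ 8 r`
      have hlog : Real.log (n + 5) ≤ 8 * r := by
        have h1 := log_le_four_mul_sqrt_sqrt (show (0 : ℝ) < n + 5 by linarith)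
        have h2 : Real.sqrt (Real.sqrt (n + 5)) ≤ Real.sqrt (Real.sqrt (16 * n)) :=
          Real.sqrt_le_sqrt (Real.sqrt_le_sqrt (by linarith))
        have h3 : Real.sqrt (Real.sqrt (16 * n)) = 2 * r := by
          rw [Real.sqrt_mul (by norm_num), show Real.sqrt 16 = 4 by
            rw [show (16 : ℝ) = 4 ^ 2 by norm_num, Real.sqrt_sq (by norm_num)],
            Real.sqrt_mul (by norm_num), show Real.sqrt 4 = 2 by
            rw [show (4 : ℝ) = 2 ^ 2 by norm_num, Real.sqrt_sq (by norm_num)], hr]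
        linarith
      have hcN : c (N + 1) = C / (n * Real.sqrt n) := by
        rw [hc_def]; dsimp only; rw [if_neg (Nat.succ_ne_zero N)]
      have hdN : d (N + 1) = D * Real.log (n + 5) := rfl
      rw [hcN, hdN, hrpow]
      have hnsq : n * Real.sqrt n = r ^ 6 := by
        rw [← hr2, ← hr4]; ring
      rw [hnsq]
      have hr5 : (0 : ℝ) < r ^ 5 := by positivity
      have hr6 : (0 : ℝ) < r ^ 6 := by positivity
      calc D * Real.log (n + 5) * (C / r ^ 6) ≤ D * (8 * r) * (C / r ^ 6) := by
            gcongr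
        _ = 8 * D * C * (r / r ^ 6) := by ring
        _ = 8 * D * C * (r ^ 5)⁻¹ := by
            field_simp
    refine Summable.of_nonneg_of_le (fun N ↦ ?_) hmaj ?_
    · have := hc0 (N + 1)
      have : 0 ≤ d (N + 1) := by simp only [hd_def]; exact mul_nonneg hD0.le (Real.log_nonneg (by
        push_cast; linarith))
      positivity
    · have h54 : Summable fun N : ℕ ↦ (((N : ℕ) : ℝ) ^ (5 / 4 : ℝ))⁻¹ :=
        Real.summable_nat_rpow_inv.2 (by norm_num)
      exact ((summable_nat_add_iff 1).2 h54).mul_left _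
  exact summable_of_antitone_blocks (approxNumber_nonneg T) (approxNumber_antitone T) hmono htop
    hc0 hc hd hdc




/-! # PART II — the trace formula `Tr 𝖦_g[a] = Σ_n λ_{a,n} = ∫ G_g(t,t) dt` (`Suzuki2023_thm15_trace`) -/

namespace ZetaScrewTraceClassProof

/-! ## I. Trace of an absolutely convergent sum of rank-one operators in a Hilbert basis -/

section TraceGeneric

variable {E : Type*} [NormedAddCommGroup E] [InnerProductSpace ℂ E] [CompleteSpace E]

omit [CompleteSpace E] in
/-- A rank-one operator `λ ⟪y, ·⟫ x` is compact (it factors through `ℂ`). [folklore] -/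
private theorem isCompactOperator_rankOne (lam : ℂ) (x y : E) :
    IsCompactOperator (⇑(lam • (innerSL ℂ y).smulRight x) : E → E) := by
  have h1 : IsCompactOperator (⇑(innerSL ℂ y : E →L[ℂ] ℂ) : E → ℂ) :=
    isCompactOperator_of_locallyCompactSpace_dom _
  have h2 : Continuous fun c : ℂ ↦ c • (lam • x) := continuous_id.smul continuous_const
  have h3 := h1.continuous_comp h2
  have heq : (⇑(lam • (innerSL ℂ y).smulRight x) : E → E) =
      (fun c : ℂ ↦ c • (lam • x)) ∘ (⇑(innerSL ℂ y : E →L[ℂ] ℂ) : E → ℂ) := by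
    funext φ
    simp only [Function.comp_apply, smul_apply, ContinuousLinearMap.smulRight_apply,
      innerSL_apply_apply, smul_smul, mul_comm lam]
  rw [heq]
  exact h3

omit [CompleteSpace E] in
/-- Finite sums of compact operators are compact. [folklore] -/
private theorem isCompactOperator_finset_sum {ι : Type*} (s : Finset ι) (F : ι → E →L[ℂ] E)
    (h : ∀ i ∈ s, IsCompactOperator (⇑(F i) : E → E)) :
    IsCompactOperator (⇑(∑ i ∈ s, F i) : E → E) := by
  classical
  induction s using Finset.induction_on with
  | empty => simp only [Finset.sum_empty]; exact isCompactOperator_zero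
  | insert i s hi ih =>
    rw [Finset.sum_insert hi, FunLike.coe_add]
    exact (h i (Finset.mem_insert_self i s)).add
      (ih fun j hj ↦ h j (Finset.mem_insert_of_mem hj))

/-- An operator-norm convergent sum of rank-one operators is compact. [folklore] -/
private theorem isCompactOperator_tsum_rankOne {ι : Type*} (u v : ι → E) (lam : ι → ℂ)
    (hF : Summable fun i ↦ lam i • (innerSL ℂ (v i)).smulRight (u i)) :
    IsCompactOperator (⇑(∑' i, lam i • (innerSL ℂ (v i)).smulRight (u i)) : E → E) := by
  have h := hF.hasSum
  rw [HasSum] at h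
  exact isCompactOperator_of_tendsto h (Eventually.of_forall fun s ↦
    isCompactOperator_finset_sum s _ fun i _ ↦ isCompactOperator_rankOne (lam i) (u i) (v i))

/-- **The trace of `T = Σ_i λ_i ⟪v_i, ·⟫ u_i` in any Hilbert basis.** If `‖u_i‖, ‖v_i‖ ≤ B` and
`Σ |λ_i| < ∞`, then for every Hilbert basis `b`, `Σ_j ⟪b_j, T b_j⟫` converges (absolutely) to
`Σ_i λ_i ⟪v_i, u_i⟫` (Parseval `Σ_j ⟪v, b_j⟫⟪b_j, u⟫ = ⟪v, u⟫`, Bessel, and Fubini for the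
absolutely convergent double series). [folklore] -/
private theorem hasSum_inner_tsum_rankOne {ι ι' : Type*} (b : HilbertBasis ι' ℂ E)
    (u v : ι → E) (lam : ι → ℂ) {B : ℝ} (hBu : ∀ i, ‖u i‖ ≤ B) (hBv : ∀ i, ‖v i‖ ≤ B)
    (hlam : Summable fun i ↦ ‖lam i‖) :
    Summable (fun i ↦ lam i • (innerSL ℂ (v i)).smulRight (u i)) ∧
      HasSum (fun j : ι' ↦ ⟪b j, (∑' i, lam i • (innerSL ℂ (v i)).smulRight (u i)) (b j)⟫_ℂ)
        (∑' i, lam i * ⟪v i, u i⟫_ℂ) := by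
  set F : ι → E →L[ℂ] E := fun i ↦ lam i • (innerSL ℂ (v i)).smulRight (u i) with hF_def
  have hF_norm : ∀ i, ‖F i‖ ≤ ‖lam i‖ * (B * B) := by
    intro i
    simp only [hF_def]
    rw [norm_smul, ContinuousLinearMap.norm_smulRight_apply, innerSL_apply_norm]
    have hB0 : 0 ≤ B := (norm_nonneg _).trans (hBu i)
    gcongr
    · exact hBv i
    · exact hBu i
  have hF : Summable F := Summable.of_norm_bounded (hlam.mul_right _) hF_norm
  refine ⟨hF, ?_⟩
  set T : E →L[ℂ] E := ∑' i, F i with hT_def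
  -- the double family, curried in `i`
  set f : ι → ι' → ℂ := fun i j ↦ lam i * (⟪v i, b j⟫_ℂ * ⟪b j, u i⟫_ℂ) with hf
  -- `⟪b j, T b j⟫ = Σ_i f i j`
  have hTj : ∀ j, HasSum (fun i ↦ f i j) ⟪b j, T (b j)⟫_ℂ := by
    intro j
    have h := (hF.hasSum.mapL (ContinuousLinearMap.apply ℂ E (b j))).mapL (innerSL ℂ (b j))
    simp only [ContinuousLinearMap.apply_apply, innerSL_apply_apply] at h
    refine h.congr_fun fun i ↦ ?_
    simp only [hf, hF_def, smul_apply, ContinuousLinearMap.smulRight_apply, innerSL_apply_apply,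
      inner_smul_right]
  -- absolute summability on `ι × ι'` via `|ab| ≤ (a² + b²)/2` and Bessel
  set Ψ : ι × ι' → ℝ := fun p ↦
    ‖lam p.1‖ * ((‖⟪b p.2, v p.1⟫_ℂ‖ ^ 2 + ‖⟪b p.2, u p.1⟫_ℂ‖ ^ 2) / 2) with hΨ
  have hΦΨ : ∀ p : ι × ι', ‖Function.uncurry f p‖ ≤ Ψ p := by
    rintro ⟨i, j⟩
    simp only [Function.uncurry_apply_pair, hf, hΨ, norm_mul]
    refine mul_le_mul_of_nonneg_left ?_ (norm_nonneg _)
    rw [norm_inner_symm (v i) (b j)]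
    nlinarith [sq_nonneg (‖⟪b j, v i⟫_ℂ‖ - ‖⟪b j, u i⟫_ℂ‖)]
  have hΨ0 : 0 ≤ Ψ := fun p ↦ by simp only [hΨ]; positivity
  have hΨ_summ : Summable Ψ := by
    rw [summable_prod_of_nonneg hΨ0]
    constructor
    · intro i
      simp only [hΨ]
      exact (((b.orthonormal.inner_products_summable (x := v i)).add
        (b.orthonormal.inner_products_summable (x := u i))).div_const 2).mul_left _
    · have hbd : ∀ i, ∑' j, Ψ (i, j) ≤ ‖lam i‖ * (B * B) := by
        intro i
        simp only [hΨ]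
        rw [tsum_mul_left]
        refine mul_le_mul_of_nonneg_left ?_ (norm_nonneg _)
        have h1 := b.orthonormal.tsum_inner_products_le (x := v i)
        have h2 := b.orthonormal.tsum_inner_products_le (x := u i)
        have hs1 := b.orthonormal.inner_products_summable (x := v i)
        have hs2 := b.orthonormal.inner_products_summable (x := u i)
        rw [tsum_div_const, hs1.tsum_add hs2]
        have hB0 : 0 ≤ B := (norm_nonneg _).trans (hBu i)
        have hv2 : ‖v i‖ ^ 2 ≤ B ^ 2 := pow_le_pow_left₀ (norm_nonneg _) (hBv i) 2
        have hu2 : ‖u i‖ ^ 2 ≤ B ^ 2 := pow_le_pow_left₀ (norm_nonneg _) (hBu i) 2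
        nlinarith
      refine Summable.of_nonneg_of_le (fun i ↦ tsum_nonneg fun j ↦ hΨ0 (i, j)) hbd
        (hlam.mul_right _)
  have hΦ_summ : Summable (Function.uncurry f) :=
    Summable.of_norm (Summable.of_nonneg_of_le (fun _ ↦ norm_nonneg _) hΦΨ hΨ_summ)
  -- summing first over `j`: Parseval
  have hrow : ∀ i, HasSum (fun j ↦ f i j) (lam i * ⟪v i, u i⟫_ℂ) := fun i ↦
    (b.hasSum_inner_mul_inner (v i) (u i)).mul_left (lam i)
  -- assemble
  have hswap : Summable (Function.uncurry f ∘ ⇑(Equiv.prodComm ι' ι)) :=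
    (Equiv.summable_iff _).2 hΦ_summ
  have hcol_summ : Summable fun j ↦ ∑' i, f i j := by
    simpa [Function.comp, Function.uncurry, Equiv.prodComm_apply, Prod.swap] using hswap.prod
  have hval : ∑' j, ∑' i, f i j = ∑' i, lam i * ⟪v i, u i⟫_ℂ := by
    rw [hΦ_summ.tsum_comm]
    exact tsum_congr fun i ↦ (hrow i).tsum_eq
  have hfun : (fun j : ι' ↦ ⟪b j, T (b j)⟫_ℂ) = fun j ↦ ∑' i, f i j :=
    funext fun j ↦ ((hTj j).tsum_eq).symm
  rw [hfun, ← hval]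
  exact hcol_summ.hasSum

end TraceGeneric


/-! ## J. Eigenvalues with multiplicity from a Hilbert basis of eigenvectors -/

section Eigen

variable {E : Type*} [NormedAddCommGroup E] [InnerProductSpace ℂ E] [CompleteSpace E]

/-- For a compact symmetric `T` diagonalised by a Hilbert basis `b` (`T bᵢ = κᵢ bᵢ`) and `μ ≠ 0`,
the indices `i` with `κᵢ = μ` form a finite set whose cardinality is `dim ker(T − μ)`: the `bᵢ`
in question are orthonormal in the finite-dimensional eigenspace and span it (an eigenvector for `μ`
is orthogonal to every `bᵢ` with `κᵢ ≠ μ`). [folklore] -/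
private theorem card_fiber_eq_finrank_eigenspace {ι : Type*} {T : E →L[ℂ] E}
    (hTc : IsCompactOperator T) (hTs : (T : E →ₗ[ℂ] E).IsSymmetric) (b : HilbertBasis ι ℂ E)
    (κ : ι → ℝ) (hTb : ∀ i, T (b i) = ((κ i : ℝ) : ℂ) • b i) {μ : ℂ} (hμ : μ ≠ 0) :
    ({i : ι | ((κ i : ℝ) : ℂ) = μ}).Finite ∧
      Nat.card {i : ι | ((κ i : ℝ) : ℂ) = μ} =
        Module.finrank ℂ (Module.End.eigenspace (T : E →ₗ[ℂ] E) μ) := by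
  classical
  set I : Set ι := {i : ι | ((κ i : ℝ) : ℂ) = μ} with hI
  haveI : FiniteDimensional ℂ (Module.End.eigenspace (T : E →ₗ[ℂ] E) μ) :=
    ContinuousLinearMap.finite_dimensional_eigenspace hTc μ hμ
  -- each `b i`, `i ∈ I`, is an eigenvector for `μ`
  have hmem : ∀ i : I, (b i : E) ∈ Module.End.eigenspace (T : E →ₗ[ℂ] E) μ := by
    intro i
    rw [Module.End.mem_eigenspace_iff, ContinuousLinearMap.coe_coe, hTb]
    have hi : ((κ i : ℝ) : ℂ) = μ := i.2
    rw [hi]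
  -- the family `i ↦ b i` on `I` is orthonormal, hence linearly independent (in `E` and in the eigenspace)
  have hon : Orthonormal ℂ (fun i : I ↦ (b i : E)) := b.orthonormal.comp _ Subtype.val_injective
  have hliE : LinearIndependent ℂ (fun i : I ↦ (b i : E)) := hon.linearIndependent
  set w : I → Module.End.eigenspace (T : E →ₗ[ℂ] E) μ := fun i ↦ ⟨b i, hmem i⟩ with hw
  have hliW : LinearIndependent ℂ w := by
    refine LinearIndependent.of_comp (Module.End.eigenspace (T : E →ₗ[ℂ] E) μ).subtype ?_
    exact hliE
  have hfin : Finite I := hliW.finite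
  have hIfin : I.Finite := Set.finite_coe_iff.1 hfin
  letI : Fintype I := hIfin.fintype
  refine ⟨hIfin, ?_⟩
  -- the span of `{b i : i ∈ I}` is the eigenspace
  have hspan : Submodule.span ℂ (Set.range fun i : I ↦ (b i : E)) =
      (Module.End.eigenspace (T : E →ₗ[ℂ] E) μ : Submodule ℂ E) := by
    refine le_antisymm (Submodule.span_le.2 ?_) fun x hx ↦ ?_
    · rintro _ ⟨i, rfl⟩; exact hmem i
    · -- expand `x` along `b`; coefficients off `I` vanish by orthogonality of eigenspaces
      have hrepr := b.hasSum_repr x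
      have hzero : ∀ i ∉ hIfin.toFinset, (b.repr x i) • b i = 0 := by
        intro i hi
        rw [Set.Finite.mem_toFinset] at hi
        have hne : ((κ i : ℝ) : ℂ) ≠ μ := hi
        have hbi : (b i : E) ∈ Module.End.eigenspace (T : E →ₗ[ℂ] E) ((κ i : ℝ) : ℂ) := by
          rw [Module.End.mem_eigenspace_iff, ContinuousLinearMap.coe_coe, hTb]
        have horth : ⟪(b i : E), x⟫_ℂ = 0 :=
          hTs.orthogonalFamily_eigenspaces hne ⟨b i, hbi⟩ ⟨x, hx⟩
        rw [HilbertBasis.repr_apply_apply, horth, zero_smul]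
      have hfinsum : HasSum (fun i ↦ (b.repr x i) • b i)
          (∑ i ∈ hIfin.toFinset, (b.repr x i) • b i) := hasSum_sum_of_ne_finset_zero hzero
      rw [hrepr.unique hfinsum]
      refine Submodule.sum_mem _ fun i hi ↦ Submodule.smul_mem _ _ (Submodule.subset_span ?_)
      rw [Set.Finite.mem_toFinset] at hi
      exact ⟨⟨i, hi⟩, rfl⟩
  have h1 : Module.finrank ℂ (Submodule.span ℂ (Set.range fun i : I ↦ (b i : E))) = Fintype.card I :=
    finrank_span_eq_card hliE
  rw [hspan] at h1
  rw [h1, Nat.card_eq_fintype_card]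

/-- **Regrouping `Σ_i κ_i` by eigenvalue.** If `T` is compact symmetric with Hilbert eigenbasis
`b`, `T bᵢ = κᵢ bᵢ`, and `Σ_i κ_i` converges to `L` (as complex numbers), then the sum over the
non-zero eigenvalues `μ` of `dim ker(T − μ) · μ` converges to `L`. [folklore] -/
private theorem hasSum_eigenvalues_of_hilbertBasis {ι : Type*} {T : E →L[ℂ] E}
    (hTc : IsCompactOperator T) (hTs : (T : E →ₗ[ℂ] E).IsSymmetric) (b : HilbertBasis ι ℂ E)
    (κ : ι → ℝ) (hTb : ∀ i, T (b i) = ((κ i : ℝ) : ℂ) • b i) {L : ℂ}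
    (hκ : HasSum (fun i ↦ ((κ i : ℝ) : ℂ)) L) :
    HasSum (fun μ : {μ : ℂ // μ ≠ 0 ∧ Module.End.HasEigenvalue (T : E →ₗ[ℂ] E) μ} ↦
      (Module.finrank ℂ (Module.End.eigenspace (T : E →ₗ[ℂ] E) (μ : ℂ)) : ℂ) * (μ : ℂ)) L := by
  classical
  set g : ι → ℂ := fun i ↦ ((κ i : ℝ) : ℂ) with hg
  have h1 := hκ.tsum_fiberwise g
  -- the fibre sums
  have hfib : ∀ c : ℂ, ∑' i : ↥(g ⁻¹' {c}), g (i : ι) = (Nat.card ↥(g ⁻¹' {c}) : ℂ) * c := by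
    intro c
    have : ∀ i : ↥(g ⁻¹' {c}), g (i : ι) = c := fun i ↦ i.2
    rw [tsum_congr this, tsum_const, nsmul_eq_mul]
  simp only [hfib] at h1
  -- support inside the non-zero eigenvalues
  have hsupp : Function.support (fun c : ℂ ↦ (Nat.card ↥(g ⁻¹' {c}) : ℂ) * c) ⊆
      {μ : ℂ | μ ≠ 0 ∧ Module.End.HasEigenvalue (T : E →ₗ[ℂ] E) μ} := by
    intro c hc
    rw [Function.mem_support] at hc
    have hc0 : c ≠ 0 := fun h ↦ hc (by rw [h, mul_zero])
    have hcard : Nat.card ↥(g ⁻¹' {c}) ≠ 0 := fun h ↦ hc (by rw [h, Nat.cast_zero, zero_mul])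
    obtain ⟨⟨i, hi⟩⟩ := (Nat.card_ne_zero.1 hcard).1
    refine ⟨hc0, Module.End.hasEigenvalue_of_hasEigenvector (x := b i) ⟨?_, ?_⟩⟩
    · rw [Module.End.mem_eigenspace_iff, ContinuousLinearMap.coe_coe, hTb]
      have : g i = c := hi
      rw [← this]
    · exact b.orthonormal.ne_zero i
  have h2 := (hasSum_subtype_iff_of_support_subset hsupp).2 h1
  refine h2.congr_fun fun μ ↦ ?_
  simp only [Function.comp_apply]
  have := (card_fiber_eq_finrank_eigenspace hTc hTs b κ hTb μ.2.1).2
  rw [← this]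
  rfl

end Eigen



/-! ## K. Hermitian symmetry of `⟨·,·⟩_{G_g,a}`, the diagonal sum, countability of the zeros -/

section TraceSpecific

variable {a : ℝ}

/-- **`⟨·,·⟩_{G_g,a}` is a hermitian form**: `conj ⟨φ,ψ⟩_{G_g,a} = ⟨ψ,φ⟩_{G_g,a}` for integrable
`φ, ψ` on the window (the kernel `G_g` is real and symmetric, `zetaScrewKernel_comm`; Fubini on the
bounded square). [cite: Suzuki2023, §1 eq. (1.10), p. 3 ("the hermitian form")] -/
theorem conj_zetaScrewForm {φ ψ : ℝ → ℂ} (hφ : Integrable φ (volume.restrict (Ioo (-a) a)))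
    (hψ : Integrable ψ (volume.restrict (Ioo (-a) a))) :
    conj (zetaScrewForm (Ioo (-a) a) φ ψ) = zetaScrewForm (Ioo (-a) a) ψ φ := by
  obtain ⟨C, hC0, hC⟩ := exists_kernel_bound a
  unfold zetaScrewForm
  rw [← integral_conj]
  simp_rw [← integral_conj, map_mul, Complex.conj_ofReal, Complex.conj_conj]
  -- now: `∫_t ∫_u G t u * conj φ u * ψ t = ∫_t ∫_u G t u * ψ u * conj φ t`
  have hφc : Integrable (fun u ↦ conj (φ u)) (volume.restrict (Ioo (-a) a)) :=
    Complex.conjLIE.toContinuousLinearEquiv.toContinuousLinearMap.integrable_comp hφ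
  -- integrability of the swapped integrand on the square
  set f : ℝ → ℝ → ℂ := fun t u ↦ (zetaScrewKernel t u : ℂ) * ψ u * conj (φ t) with hf
  have hprod : Integrable (Function.uncurry f)
      ((volume.restrict (Ioo (-a) a)).prod (volume.restrict (Ioo (-a) a))) := by
    have h1 : Integrable (fun z : ℝ × ℝ ↦ conj (φ z.1) * ψ z.2)
        ((volume.restrict (Ioo (-a) a)).prod (volume.restrict (Ioo (-a) a))) := hφc.mul_prod hψ
    have hGm : AEStronglyMeasurable (fun z : ℝ × ℝ ↦ (zetaScrewKernel z.1 z.2 : ℂ))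
        ((volume.restrict (Ioo (-a) a)).prod (volume.restrict (Ioo (-a) a))) :=
      (continuous_ofReal.comp continuous_zetaScrewKernel_uncurry).aestronglyMeasurable
    have hbd : ∀ᵐ z : ℝ × ℝ ∂((volume.restrict (Ioo (-a) a)).prod (volume.restrict (Ioo (-a) a))),
        ‖(zetaScrewKernel z.1 z.2 : ℂ)‖ ≤ C := by
      rw [Measure.prod_restrict]
      refine (ae_restrict_mem (measurableSet_Ioo.prod measurableSet_Ioo)).mono fun z hz ↦ ?_
      exact hC z.1 (Ioo_subset_Icc_self hz.1) z.2 (Ioo_subset_Icc_self hz.2)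
    refine (h1.bdd_mul hGm hbd).congr (Eventually.of_forall fun z ↦ ?_)
    simp only [Function.uncurry, hf]
    ring
  have hswap := integral_integral_swap hprod
  simp only [hf] at hswap
  rw [hswap]
  refine integral_congr_ae (Eventually.of_forall fun u ↦ ?_)
  refine integral_congr_ae (Eventually.of_forall fun t ↦ ?_)
  simp only
  rw [zetaScrewKernel_comm t u]
  ring

/-- An operator realising (1.12) is symmetric: `⟪Tφ, ψ⟫ = ⟪φ, Tψ⟫` (hermitian kernel). [cite: Suzuki2023, §5 p. 15 ("a self-adjoint Hilbert–Schmidt operator")] -/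
theorem isSymmetric_of_realises (ha : 0 < a)
    {T : Lp ℂ 2 (volume.restrict (Ioo (-a) a)) →L[ℂ] Lp ℂ 2 (volume.restrict (Ioo (-a) a))}
    (hT : ∀ φ : Lp ℂ 2 (volume.restrict (Ioo (-a) a)),
      (T φ : ℝ → ℂ) =ᵐ[volume.restrict (Ioo (-a) a)] zetaScrewOp (Ioo (-a) a) φ) :
    (T : Lp ℂ 2 (volume.restrict (Ioo (-a) a)) →ₗ[ℂ] Lp ℂ 2 (volume.restrict (Ioo (-a) a))).IsSymmetric := by
  have _ := ha
  have hTeq : ∀ φ : Lp ℂ 2 (volume.restrict (Ioo (-a) a)), T φ = (memLp_zetaScrewOp φ).toLp _ :=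
    fun φ ↦ Lp.ext ((hT φ).trans (MemLp.coeFn_toLp _).symm)
  intro φ ψ
  rw [ContinuousLinearMap.coe_coe, ← inner_conj_symm, hTeq φ, ← zetaScrewForm_eq_inner,
    conj_zetaScrewForm ((Lp.memLp φ).integrable one_le_two) ((Lp.memLp ψ).integrable one_le_two),
    zetaScrewForm_eq_inner, ← hTeq ψ]

/-- The non-trivial zeros of `ζ` form a countable set (finitely many in each horizontal strip
`|Im ρ| ≤ N`). [folklore] -/
private theorem countable_zeros : Countable ZetaZeros.riemannZetaNontrivialZeros := by
  have h : (Set.univ : Set ZetaZeros.riemannZetaNontrivialZeros) ⊆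
      ⋃ N : ℕ, {ρ : ZetaZeros.riemannZetaNontrivialZeros | |(ρ : ℂ).im| ≤ (N : ℝ)} := by
    intro ρ _
    obtain ⟨N, hN⟩ := exists_nat_ge |(ρ : ℂ).im|
    exact Set.mem_iUnion.2 ⟨N, hN⟩
  have hc : (Set.univ : Set ZetaZeros.riemannZetaNontrivialZeros).Countable :=
    (Set.countable_iUnion fun N : ℕ ↦ (finite_abs_im_le (N : ℝ)).countable).mono h
  exact Set.countable_univ_iff.1 hc

/-- `‖cosh z‖ ≤ cosh(Re z)`. [folklore] -/
private theorem norm_cosh_le_cosh_re (z : ℂ) : ‖Complex.cosh z‖ ≤ Real.cosh z.re := by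
  rw [Complex.cosh, Real.cosh_eq, norm_div, Complex.norm_ofNat]
  gcongr
  calc ‖Complex.exp z + Complex.exp (-z)‖
      ≤ ‖Complex.exp z‖ + ‖Complex.exp (-z)‖ := norm_add_le _ _
    _ = Real.exp z.re + Real.exp (-z.re) := by rw [Complex.norm_exp, Complex.norm_exp, neg_re]

/-- `‖cosh(κu) − 1‖ ≤ cosh(a/2) + 1` for `|Re κ| ≤ ½` and `|u| ≤ a`. [folklore] -/
private theorem norm_cosh_sub_one_le {κ : ℂ} (hκ : |κ.re| ≤ 1 / 2) {u a : ℝ} (hu : |u| ≤ a) :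
    ‖Complex.cosh (κ * u) - 1‖ ≤ Real.cosh (a / 2) + 1 := by
  refine (norm_sub_le _ _).trans ?_
  rw [norm_one]
  gcongr
  refine (norm_cosh_le_cosh_re _).trans ?_
  rw [Real.cosh_le_cosh, Complex.re_mul_ofReal, abs_mul]
  have ha : 0 ≤ a := (abs_nonneg u).trans hu
  rw [abs_of_nonneg (by linarith : 0 ≤ a / 2)]
  calc |κ.re| * |u| ≤ 1 / 2 * a := mul_le_mul hκ hu (abs_nonneg _) (by norm_num)
    _ = a / 2 := by ring

end TraceSpecific


/-! ## L. The diagonal sum `Σ_ρ λ_ρ ⟪y_ρ, x_ρ⟫ = ∫ G_g(t,t) dt` -/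

section Diagonal

variable {a : ℝ}

/-- For the exponential family: `(−m(ρ)/κ²)·⟪e(κ̄) − 1, e(−κ) − 1⟫ = ∫_{(−a,a)} 2 m(ρ) (cosh κu − 1)/κ² du`
(`κ = ρ − ½`). [folklore] -/
private theorem coeff_mul_inner_eq_integral (e : ℂ → Lp ℂ 2 (volume.restrict (Ioo (-a) a)))
    (he : ∀ z, (e z : ℝ → ℂ) =ᵐ[volume.restrict (Ioo (-a) a)] fun u ↦ cexp (z * u))
    (ρ : ZetaZeros.riemannZetaNontrivialZeros) :
    -((riemannZetaZeroOrder (ρ : ℂ) : ℂ)) / ((ρ : ℂ) - 1 / 2) ^ 2 *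
        ⟪e (conj ((ρ : ℂ) - 1 / 2)) - e 0, e (-((ρ : ℂ) - 1 / 2)) - e 0⟫_ℂ =
      ∫ u, 2 * ((riemannZetaZeroOrder (ρ : ℂ) : ℂ) *
        ((Complex.cosh (((ρ : ℂ) - 1 / 2) * (u : ℂ)) - 1) / ((ρ : ℂ) - 1 / 2) ^ 2))
        ∂(volume.restrict (Ioo (-a) a)) := by
  set κ : ℂ := (ρ : ℂ) - 1 / 2 with hκ
  set x : Lp ℂ 2 (volume.restrict (Ioo (-a) a)) := e (-κ) - e 0 with hx
  have hxi : Integrable (x : ℝ → ℂ) (volume.restrict (Ioo (-a) a)) :=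
    (Lp.memLp x).integrable one_le_two
  have hxae : (x : ℝ → ℂ) =ᵐ[volume.restrict (Ioo (-a) a)] fun u ↦ cexp (-κ * u) - 1 := by
    filter_upwards [Lp.coeFn_sub (e (-κ)) (e 0), he (-κ), he 0] with u h1 h2 h3
    rw [h1, Pi.sub_apply, h2, h3, zero_mul, Complex.exp_zero]
  have hy : ⟪e (conj κ) - e 0, x⟫_ℂ =
      ∫ u, (cexp (κ * u) - 1) * (x : ℝ → ℂ) u ∂(volume.restrict (Ioo (-a) a)) := by
    rw [inner_sub_left, inner_expVec_left e he, inner_expVec_left e he, Complex.conj_conj, map_zero,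
      ← integral_sub (integrable_cexp_mul hxi κ) (integrable_cexp_mul hxi 0)]
    refine integral_congr_ae (Eventually.of_forall fun u ↦ ?_)
    simp only [zero_mul, Complex.exp_zero]
    ring
  rw [hy, ← integral_const_mul]
  refine integral_congr_ae (hxae.mono fun u hu ↦ ?_)
  simp only [hu]
  have hEE : cexp (κ * u) * cexp (-(κ * u)) = 1 := by
    rw [← Complex.exp_add, add_neg_cancel, Complex.exp_zero]
  rw [neg_mul, Complex.cosh]
  linear_combination (-((riemannZetaZeroOrder (ρ : ℂ) : ℂ)) / κ ^ 2) * hEE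

/-- **The diagonal of the rank-one expansion sums to `∫_{(−a,a)} G_g(t,t) dt`**:
`Σ_ρ (−m(ρ)/κ²)⟪e(κ̄)−1, e(−κ)−1⟫ = ∫ 2Ψ(t) dt = ∫ G_g(t,t) dt` ((1.9) on the diagonal,
`ZetaScrewProp31.hasSum_zetaScrew`, termwise integration). [cite: Suzuki2023, eq. (1.9) p. 3] -/
private theorem hasSum_coeff_mul_inner (ha : 0 < a) (e : ℂ → Lp ℂ 2 (volume.restrict (Ioo (-a) a)))
    (he : ∀ z, (e z : ℝ → ℂ) =ᵐ[volume.restrict (Ioo (-a) a)] fun u ↦ cexp (z * u)) :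
    HasSum (fun ρ : ZetaZeros.riemannZetaNontrivialZeros ↦
      -((riemannZetaZeroOrder (ρ : ℂ) : ℂ)) / ((ρ : ℂ) - 1 / 2) ^ 2 *
        ⟪e (conj ((ρ : ℂ) - 1 / 2)) - e 0, e (-((ρ : ℂ) - 1 / 2)) - e 0⟫_ℂ)
      (∫ t in Ioo (-a) a, (zetaScrewKernel t t : ℂ)) := by
  haveI : Countable ZetaZeros.riemannZetaNontrivialZeros := countable_zeros
  set d : ZetaZeros.riemannZetaNontrivialZeros → ℝ → ℂ := fun ρ u ↦
    2 * ((riemannZetaZeroOrder (ρ : ℂ) : ℂ) *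
      ((Complex.cosh (((ρ : ℂ) - 1 / 2) * (u : ℂ)) - 1) / ((ρ : ℂ) - 1 / 2) ^ 2)) with hd
  have hm0 : ∀ ρ : ZetaZeros.riemannZetaNontrivialZeros, 0 ≤ (riemannZetaZeroOrder (ρ : ℂ) : ℝ) :=
    fun ρ ↦ ZetaZeroSum.zeroOrder_nonneg ρ
  -- integrability and norm bounds of the terms
  have hcont : ∀ ρ : ZetaZeros.riemannZetaNontrivialZeros, Continuous (d ρ) := by
    intro ρ; simp only [hd]; fun_prop
  have hint : ∀ ρ : ZetaZeros.riemannZetaNontrivialZeros, Integrable (d ρ) (volume.restrict (Ioo (-a) a)) :=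
    fun ρ ↦ ((hcont ρ).integrableOn_Icc (a := -a) (b := a)).mono_set Ioo_subset_Icc_self
  have hbd : ∀ ρ : ZetaZeros.riemannZetaNontrivialZeros, ∀ u ∈ Ioo (-a) a,
      ‖d ρ u‖ ≤ 2 * ((riemannZetaZeroOrder (ρ : ℂ) : ℝ) * ((Real.cosh (a / 2) + 1) / ‖(ρ : ℂ) - 1 / 2‖ ^ 2)) := by
    intro ρ u hu
    simp only [hd, norm_mul, Complex.norm_ofNat, norm_div, norm_pow, Complex.norm_intCast,
      abs_of_nonneg (hm0 ρ)]
    have hu' : |u| ≤ a := abs_le.2 ⟨hu.1.le, hu.2.le⟩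
    have h := norm_cosh_sub_one_le (abs_re_kappa_le ρ) hu'
    gcongr
    exact hm0 ρ
  have hnorm_int : ∀ ρ : ZetaZeros.riemannZetaNontrivialZeros,
      ∫ u, ‖d ρ u‖ ∂(volume.restrict (Ioo (-a) a)) ≤
        2 * ((riemannZetaZeroOrder (ρ : ℂ) : ℝ) * ((Real.cosh (a / 2) + 1) / ‖(ρ : ℂ) - 1 / 2‖ ^ 2)) *
          (2 * a) := by
    intro ρ
    have h1 := setIntegral_mono_on (hint ρ).norm (integrableOn_const (by simp))
      measurableSet_Ioo (hbd ρ)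
    refine h1.trans (le_of_eq ?_)
    rw [setIntegral_const, measureReal_def, Real.volume_Ioo,
      ENNReal.toReal_ofReal (by linarith), smul_eq_mul]
    ring
  have hsum_norm : Summable fun ρ : ZetaZeros.riemannZetaNontrivialZeros ↦
      ∫ u, ‖d ρ u‖ ∂(volume.restrict (Ioo (-a) a)) := by
    refine Summable.of_nonneg_of_le (fun ρ ↦ integral_nonneg fun _ ↦ norm_nonneg _) hnorm_int ?_
    have h := ZetaScrewProp31.summable_zeroOrder_div_norm_sub_half_sq
    refine ((h.mul_left (2 * (Real.cosh (a / 2) + 1))).mul_right (2 * a)).congr fun ρ ↦ ?_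
    ring
  -- termwise integration
  have hswap := integral_tsum_of_summable_integral_norm hint hsum_norm
  -- the pointwise sum is `G_g(u,u) = 2Ψ(u)`
  have hpt : ∀ u : ℝ, ∑' ρ : ZetaZeros.riemannZetaNontrivialZeros, d ρ u = (zetaScrewKernel u u : ℂ) := by
    intro u
    have h := (ZetaScrewProp31.hasSum_zetaScrew u).mul_left 2
    rw [zetaScrewKernel_self]
    push_cast
    exact h.tsum_eq
  have hrhs : ∫ u, ∑' ρ : ZetaZeros.riemannZetaNontrivialZeros, d ρ u ∂(volume.restrict (Ioo (-a) a)) =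
      ∫ t in Ioo (-a) a, (zetaScrewKernel t t : ℂ) :=
    integral_congr_ae (Eventually.of_forall hpt)
  -- summability of the integrated terms
  have hsum_int : Summable fun ρ : ZetaZeros.riemannZetaNontrivialZeros ↦
      ∫ u, d ρ u ∂(volume.restrict (Ioo (-a) a)) :=
    Summable.of_norm_bounded hsum_norm fun ρ ↦ norm_integral_le_integral_norm _
  have hfun : (fun ρ : ZetaZeros.riemannZetaNontrivialZeros ↦
      -((riemannZetaZeroOrder (ρ : ℂ) : ℂ)) / ((ρ : ℂ) - 1 / 2) ^ 2 *
        ⟪e (conj ((ρ : ℂ) - 1 / 2)) - e 0, e (-((ρ : ℂ) - 1 / 2)) - e 0⟫_ℂ) =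
      fun ρ ↦ ∫ u, d ρ u ∂(volume.restrict (Ioo (-a) a)) :=
    funext fun ρ ↦ coeff_mul_inner_eq_integral e he ρ
  rw [hfun, ← hrhs, ← hswap]
  exact hsum_int.hasSum

end Diagonal

end ZetaScrewTraceClassProof

open ConnesConsani2021 ZetaScrewTraceClassProof in
/-- **DISCHARGE of `Suzuki2023_thm15_trace` (the trace formula displayed after Thm. 1.5):** for every
`0 < a` and every bounded `T` on `L²(−a,a)` realising (1.12), `Σ_μ dim ker(T − μ)·μ` over the non-zero
eigenvalues converges to `∫_{(−a,a)} G_g(t,t) dt` ("`Tr 𝖦_g[a] = Σ_{n≥1} λ_{a,n} = ∫_{−a}^{a} G_g(t,t) dt`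
… [GGK01, Ch. IV, Thm. 8.1]"). Proof: `T` is the rank-one zero expansion of `Suzuki2023_thm15_holds`
(uniqueness from the a.e. clause); it is compact (norm limit of finite rank) and symmetric (hermitian
kernel, `conj_zetaScrewForm`), so the tree's Hilbert–Schmidt theorem
(`Literature.Analysis.OperatorTheory.exists_hilbertBasis_eigenvectors`) gives a Hilbert basis of
eigenvectors `T bᵢ = κᵢ bᵢ`; `Σ_i κ_i = Σ_i ⟪bᵢ, T bᵢ⟫ = Σ_ρ λ_ρ⟪y_ρ, x_ρ⟫` (absolutely; Parseval and
Bessel) `= ∫ G_g(t,t) dt` ((1.9) on the diagonal), and regrouping by eigenvalue counts each non-zero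
`μ` exactly `dim ker(T − μ)` times. RH-FREE. [cite: Suzuki2023, §1 display after Thm 1.5, p. 3 (held text p0003:L112–118)] -/
theorem Suzuki2023_thm15_trace_holds : Suzuki2023_thm15_trace := by
  intro a ha T hT
  classical
  -- the exponentials and the rank-one expansion `T₀`
  set e : ℂ → Lp ℂ 2 (volume.restrict (Ioo (-a) a)) := fun z ↦
    (memLp_two_cexp a z).toLp (fun u : ℝ ↦ cexp (z * u)) with he_def
  have he : ∀ z, (e z : ℝ → ℂ) =ᵐ[volume.restrict (Ioo (-a) a)] fun u ↦ cexp (z * u) :=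
    fun z ↦ MemLp.coeFn_toLp _
  obtain ⟨C, -, hsumm, -⟩ := approxNumber_screwOp_le ha e he
  set T₀ : Lp ℂ 2 (volume.restrict (Ioo (-a) a)) →L[ℂ] Lp ℂ 2 (volume.restrict (Ioo (-a) a)) :=
    ∑' ρ : ZetaZeros.riemannZetaNontrivialZeros,
      (-((riemannZetaZeroOrder (ρ : ℂ) : ℂ)) / ((ρ : ℂ) - 1 / 2) ^ 2) •
        (innerSL ℂ (e (conj ((ρ : ℂ) - 1 / 2)) - e 0)).smulRight (e (-((ρ : ℂ) - 1 / 2)) - e 0)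
    with hT₀_def
  have hT₀ : ∀ φ, (T₀ φ : ℝ → ℂ) =ᵐ[volume.restrict (Ioo (-a) a)] zetaScrewOp (Ioo (-a) a) φ :=
    fun φ ↦ tsum_rankOne_apply_ae_eq_zetaScrewOp ha e he hsumm.hasSum φ
  -- uniqueness: `T = T₀`
  have hTT₀ : T = T₀ := ContinuousLinearMap.ext fun φ ↦ Lp.ext ((hT φ).trans (hT₀ φ).symm)
  subst hTT₀
  -- compact and symmetric
  have hc : IsCompactOperator (⇑(∑' ρ : ZetaZeros.riemannZetaNontrivialZeros,
      (-((riemannZetaZeroOrder (ρ : ℂ) : ℂ)) / ((ρ : ℂ) - 1 / 2) ^ 2) •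
        (innerSL ℂ (e (conj ((ρ : ℂ) - 1 / 2)) - e 0)).smulRight (e (-((ρ : ℂ) - 1 / 2)) - e 0)) :
      Lp ℂ 2 (volume.restrict (Ioo (-a) a)) → Lp ℂ 2 (volume.restrict (Ioo (-a) a))) :=
    isCompactOperator_tsum_rankOne _ _ _ hsumm
  have hs := isSymmetric_of_realises ha hT
  -- a Hilbert basis of eigenvectors
  obtain ⟨s, b, κ, -, hTb⟩ :=
    Literature.Analysis.OperatorTheory.exists_hilbertBasis_eigenvectors hc hs
  -- norm bounds as in Thm 1.5
  set B : ℝ := Real.sqrt (2 * a * Real.exp a) with hB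
  have hnorm : ∀ z : ℂ, |z.re| ≤ 1 / 2 → ‖e z‖ ≤ B := fun z hz ↦
    (Real.le_sqrt (norm_nonneg _) (by positivity)).2 (norm_expVec_sq_le e ha he hz)
  have hB0 : 0 ≤ B := Real.sqrt_nonneg _
  have hBu : ∀ ρ : ZetaZeros.riemannZetaNontrivialZeros, ‖e (-((ρ : ℂ) - 1 / 2)) - e 0‖ ≤ 2 * B := by
    intro ρ
    refine (norm_sub_le _ _).trans ?_
    have h1 := hnorm (-((ρ : ℂ) - 1 / 2)) (by rw [neg_re, abs_neg]; exact abs_re_kappa_le ρ)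
    have h2 := hnorm 0 (by simp)
    linarith
  have hBv : ∀ ρ : ZetaZeros.riemannZetaNontrivialZeros, ‖e (conj ((ρ : ℂ) - 1 / 2)) - e 0‖ ≤ 2 * B := by
    intro ρ
    refine (norm_sub_le _ _).trans ?_
    have h1 := hnorm (conj ((ρ : ℂ) - 1 / 2)) (by rw [conj_re]; exact abs_re_kappa_le ρ)
    have h2 := hnorm 0 (by simp)
    linarith
  have hlam : Summable fun ρ : ZetaZeros.riemannZetaNontrivialZeros ↦
      ‖-((riemannZetaZeroOrder (ρ : ℂ) : ℂ)) / ((ρ : ℂ) - 1 / 2) ^ 2‖ := by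
    refine ZetaScrewProp31.summable_zeroOrder_div_norm_sub_half_sq.congr fun ρ ↦ ?_
    rw [norm_coeff]
  -- the trace in the basis `b`
  obtain ⟨-, htr⟩ := hasSum_inner_tsum_rankOne b
    (fun ρ : ZetaZeros.riemannZetaNontrivialZeros ↦ e (-((ρ : ℂ) - 1 / 2)) - e 0)
    (fun ρ ↦ e (conj ((ρ : ℂ) - 1 / 2)) - e 0)
    (fun ρ ↦ -((riemannZetaZeroOrder (ρ : ℂ) : ℂ)) / ((ρ : ℂ) - 1 / 2) ^ 2) hBu hBv hlam
  -- the diagonal sum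
  have hdiag := hasSum_coeff_mul_inner ha e he
  rw [hdiag.tsum_eq] at htr
  -- `⟪b i, T b i⟫ = κ i`
  have hκ : HasSum (fun i : s ↦ ((κ i : ℝ) : ℂ)) (∫ t in Ioo (-a) a, (zetaScrewKernel t t : ℂ)) := by
    refine htr.congr_fun fun i ↦ ?_
    rw [hTb i, inner_smul_right, inner_self_eq_norm_sq_to_K, b.orthonormal.1 i]
    simp
  exact hasSum_eigenvalues_of_hilbertBasis hc hs b κ hTb hκ


end Literature.NumberTheory.LFunctions

end
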